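import Summits.HodgeConjecture.HodgeConjecture.Cruxes.H413.Lines.R90_S5_HSideExportC      -- S5-C ED. 4 (tree c1e54c87eef5c5fa, BUILT): `PacketGOfRecord 𝔩 𝔞 μ Pk`, `PacketHOfRecord`, `nGOfRecord`, `nHOfRecord`, `IsRealisedH`, `discHOfRecord`, `Φ`
import Summits.HodgeConjecture.HodgeConjecture.Theorems.R90S5SpectralPacketHOfOneDim       -- ★ p862138 (K2E1-p12, DEAL #20): `spectralPacketHOfOneDim`, `IsOneDimH`, `piTwoOfOneDim`, `chiOneOfOneDim`, `discH_shape_rhoXi`, `eq_archH_of_discH_shape`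
import Summits.HodgeConjecture.HodgeConjecture.Theorems.R90S5SpectralPacketHOfOneDimU      -- (ED. 2b) ★ p863058 (R90-C133-p03, W3): `spectralPacketHOfOneDimU`, `isOneDimH_spectralPacketHOfOneDimU`, `isOneDimH_iff_exists_eq_spectralPacketHOfOneDimU`, `discH_shape_rhoXiU`, `eq_archH_of_discH_shapeU`; re-exports ★ p863008 (W1) `R90S4OneDimHLawU`: `LocalPacketKit.OneDimHLawU`, `OneDimHLaw.toU`, `GlobalPacketH.rhoXiU`, `memH_rhoXiU_loc`, `rhoXiU_toU_eq_rhoXi`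
import Summits.HodgeConjecture.HodgeConjecture.Theorems.R90S5APacketGOfOneDimU            -- (ED. 2c) ★ p863612 (R90-C133-p01, «S9-READERS (R-b)»): `GlobalPacketH.imageG`, `aPacketGOfOneDimU`, `aPacketGOfOneDimU_fin_loc`, `liftsTo_shape_aPacketGOfOneDimU`, `eq_aPacketGOfOneDimU_of_liftsTo_shape`, `aPacketGOfOneDimU_n_eq_half`; re-exports ★ p863407 `R90S5XiHFibreOneDimU`: `LocalPacketKit.XiHFibreLawOneDim` (ℓ-ξfib), `eq_of_isOneDimH_of_liftsTo_shape`, `eq_spectralPacketHOfOneDimU_of_forall_xiH_eq`, `n_eq_half_of_isOneDimH_of_liftsTo_shape`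
import Summits.HodgeConjecture.HodgeConjecture.Theorems.R90S5ThetaOfRecordDefs             -- ★ p861825 (R90-C133-p03, DEAL #11): `R90.S5.IsThetaOfRecord L μω π₂` (θ-lifts of record, θ regular)
import Summits.HodgeConjecture.HodgeConjecture.Theorems.R90S5OneDimNotThetaOfRecordXi      -- ★ (R90-C133-p03 ξ-corollary of ★ p862110 R90-C14-p02 DEAL #17b′): `not_isThetaOfRecord_piTwoOfOneDim μω hμu ξ` (law (T′) GLOBAL at `ξ`'s `U(Φ₂)`-string)
import Summits.HodgeConjecture.HodgeConjecture.Theorems.K2E1SpectralTermsDiscreteHalf       -- ★ E1: `DiscreteClass 𝒢 μ` (discrete automorphic representations up to unitary equivalence), `DiscreteClass.mk`, `DiscreteClass.mult`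
import Literature.NumberTheory.Rogawski1990.GlobalPackets                                   -- ★ `GlobalPacketData TG TH` (the 15-field dictionary datum), `GlobalPacketData.PacketTrichotomy`
import HarnessLib

/-!
# R90-TF · S5 «Ch13.3 mult∕rigidity» — file C2: THE `𝔊` OF RECORD (`GlobalPacketData` term)  (ED. 1)

Crux `H413` (`stmt-HodgeConjecture-24833`), route `route-HodgeConjecture-HCCMUnconditional`; R90-C133 S5-typ1 pen = K2E1-typ1 (g0).
Dealer rulings of record: R90-C133-plan (g0) 16:36:33Z (J3-R1…R6), 16:42:37Z (A) JQ-1…JQ-9 «=», 16:46:36Z «JQ-9 SETTLED = CLOSED AT THE RECORD»;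
LEAD #22 (J-D2-2); S10 HEADS-D.v3 §K.1 (R90-C138-typ2, frozen 16:38:48Z); R90-C133-p01 PREFLIGHT-J3-pins (ad55226fdc7d004f) + (P4) 4-lemma chain 16:43:46Z.

WHAT THIS FILE IS.  S10-F's `TwistedComparisonData.𝔊 : GlobalPacketData.{0} (TestG L) (TestH L)` needs ONE TERM whose fifteen fields are the S5 objects OF RECORD
(file C §1–§2′), so that the dictionary pins (P1)–(P5) of ★ `xiRigiditySharpQsAt_of_memLaw_of_pins` unfold BY `rfl` against the record.  This file supplies that term,
`gOfRecord`, with EVERY kit ∕ measure ∕ datum a PARAMETER (programme law L8: nothing instance-specific is frozen here; S10-F instantiates at S4's `rogawskiLocalKit …`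
AT THE SAME local data `(νG, νH, Δ, mH, mG)` the (QS-U) closer uses — dealer 16:45:03Z (1)(b) «the C2 byte rule»), plus the `rfl` ∕ ext read-backs the consumers need.
NO statement of content is made: no `sorry`, no stub; the only theorems are unfoldings, two structure-extensionality facts, the functionality of `liftsTo`, the
(P4)-instantiation at `cls := DiscreteClass.mk P`, the one-dimensional read-back under (ℓ8), and `PacketTrichotomy` — which at the record's bodies is PURE LOGIC
(`IsEndoscopic := lifts from some ρ ∧ ¬ IsAPacket`, `IsStable := lifts from no ρ`; print p. 201 ll. 16–18 on DISCRETE packets, where Thm. 13.3.2 makes «`ρ` cuspidal,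
`ρ ≠ ρ(θ)` semi-regular» automatic).

THE FIFTEEN FIELDS (body ∕ source):
* `Rep := DiscreteClass (U(Φ₃) datum) μ` (★ E1; J3-R1) · `m c := c.mult.toNat` (J3-R1; (P1) `m (mk P) ≠ 0` is ★ p862122 `DiscreteClass.m_mk_ne_zero`-shaped, K2E4-p14 DEAL #19).
* `Packet := PacketGOfRecord 𝔩 𝔞 μ Pk` (C ED. 4: coherent, type-homogeneous discrete packets; J-D2-2).
* `mem := MemOfRecord` — UNIVERSAL OVER REPRESENTATIVES (JQ-2 «=»): `mem c Q :↔ ∀ P, mk P = c → ∀ v c′, ‹c′ is a v-constituent of P, ★ D6 currency = the antecedent of pin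
  (P4) `hPin_memA` token for token› → c′ ∈ (𝔩 v).mem (Q.1.fin.loc v)`; instantiation at `cls := mk P` is `MemOfRecord.apply_mk` (by `rfl`).
* `PacketH := PacketHOfRecord 𝔩 𝔞 𝔞H μ₂ μ₁ archH` (C ED. 3∕4; J3-R5).
* `liftsTo := LiftsToOfRecord`: `∀ v, Q.1.fin.loc v = (𝔩 v).xiH (ρ.fin.loc v)` (★ kit transfer `LocalPacketKit.xiH`; J3-R4 AMENDED 16:42:37Z) — FUNCTIONAL (`LiftsToOfRecord.packet_eq`,
  via `PacketGOfRecord.ext_fin`: a coherent homogeneous packet is determined by its finite part).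
* `IsAPacket := IsAPacketOfRecord`: `∃ ρ, IsOneDimH ρ ∧ LiftsToOfRecord ρ Q` — print's `Π_a(G) = {Π(ξ) : ξ ∈ Π(H), dim ξ = 1}` VERBATIM and KIT-LAW-FREE (★ p862138 `IsOneDimH`);
  the dealer's JQ-3 reading «`∃ ξ, liftsTo (packetHOfOneDim ξ) Q`» is the READ-BACK `isAPacketOfRecord_iff_exists_packetHOfOneDim` under (ℓ8) `h8` (so the datum itself carries
  no kit-law pin; ★ `PacketGerm` (3) then unfolds to `id`).  NO term «`aPacketOfRecord ξ`»: its `isDiscrete` would be Thm. 13.3.7 content (dealer: «correct, never a def»).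
* `IsStable Q :↔ ¬ ∃ ρ, LiftsToOfRecord ρ Q`; `IsEndoscopic Q :↔ (∃ ρ, LiftsToOfRecord ρ Q) ∧ ¬ IsAPacketOfRecord Q` (p. 201 ll. 16–18; not read by the seven core laws' S5 pins).
* `IsTheta ρ :↔ IsThetaFin ρ.fin`, `IsThetaFin σ :↔ ∃ π₂ χ₁ hχ₁, IsRealisedH 𝔩 μ₂ μ₁ σ π₂ χ₁ hχ₁ ∧ R90.S5.IsThetaOfRecord L μω π₂` (JQ-4 «=»: ★ p861825 on the REALISING
  `π₂`-string); `IsThetaRegular := IsTheta` (★ `IsThetaOfRecord` quantifies `θ₁ ≠ θ₃` = regular; the semi-regular `ρ(θ)` have non-discrete `Π(ρ)` (Thm. 13.3.2) — flagged, not modelled further).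
* `pair := pairG` — a PARAMETER (JQ-6 «=» option (a): the sign `⟨ρ, π⟩` is E-S4∕S7's export `wXi`∕`ε`; a by-name body would need a constituent CHOICE on classes).
* `n := nGOfRecord 𝔩 𝔞 μ μ₂ μ₁ Pk` (C ED. 4 :302), `nH := nHOfRecord (IsThetaFin …)` (C §2).
* 𝔨-level (J3-R5, for S10-F's `TwistedComparisonData.IsOneDimH`): `IsOneDimH := ★ R90.S5.IsOneDimH` and the CLOSED constructor `packetHOfOneDim h8 hunr ξ :=
  spectralPacketHOfOneDim h8 ξ (archH (piTwoOfOneDim ξ) (chiOneOfOneDim ξ)) (hunr ξ) (discH_shape_rhoXi μ₂ μ₁ h8 archH ξ)` (JQ-9 SETTLED), with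
  `isOneDimH_iff_eq_packetHOfOneDim : IsOneDimH ρ ↔ ∃ ξ, ρ = packetHOfOneDim … ξ` proved here from ★ `isOneDimH_iff_exists_eq_spectralPacketHOfOneDim` + ★ `eq_archH_of_discH_shape`.

FORM NOTE. ★ `Rogawski1990.qsForm L` (S10's currency) and `F0P3InnerFormClassificationV6.splitForm L 3` (C's) are the SAME `Matrix.of` abbrev body (`qsForm_eq_splitForm` below, `rfl`),
so S10's `cmDatum L 3 (qsForm L)` ∕ `adelicGroupData … 3 (qsForm L)` tokens elaborate against this file with no transport.
HONEST LABEL: HC_CM is proved only modulo the 7 printed citations (2 remaining named inputs: hLiu418 = stmt-HodgeConjecture-24832, h413 = stmt-HodgeConjecture-24833) until rung 0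
closes; this file is DEFINITIONS of record + `rfl`∕ext read-backs, count-neutral. [cite: Rogawski1990, §13.3 pp. 201–203, Thm. 13.3.2 p. 201, Thm. 13.3.5 p. 202, Thm. 13.3.7 pp. 202–203; §13.6 (13.6.1) p. 208; §14.6 (14.6.1) p. 241]

ED. 2a (S5 dealer RULING S5-R5 (g2) 2026-09-04T23:00:23Z «ROAD 0 = GO»; typist K2E1-typ1 (g2), HEADS `K2/K2E1-typ1/g2/HEADS-C2.ed2.md` 71579e5c9c52b019; R-QS1-7: every ED. 1
declaration AND docstring above and below is BYTE-FROZEN — this paragraph and the trailing `section LawFreeOneDim` (§5) are the only additions; NO new import, NO def∕structure∕instance).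
WHAT §5 ADDS AND WHY.  The F-facing head of §4, `not_isThetaFin_of_isOneDimH hμu h8 hunr h1` (S10-F's ONLY contact with (ℓ8): `oneDimNotTheta_of_record`,
`aPacketMult_of_record_of_isOneDimH`, its §5 CERT), is re-proved WITHOUT the (ℓ8) pin `h8 : ∀ v, (𝔩 v).OneDimHLaw` and WITHOUT the unramifiedness datum `hunr`:
★ `IsOneDimH ρ := ∃ ξ, ρ.fin.IsCharPacket (ξ_v) …` is KIT-LAW-FREE and already says `memH (ρ.fin.loc v) = {⟦ξ_v⟧}` at every `v`, which is ALL that §4 extracted from `h8`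
(via ★ `memH_rhoXi_loc`); pair uniqueness then needs only ★ `IrrClass.boxChar_eq_boxChar_iff` + ★ `boxChar_chiOneOfOneDim_piTwoOfOneDim`, and ★ `not_isThetaOfRecord_piTwoOfOneDim`
finishes.  New decls: `eq_piTwoOfOneDim_and_eq_chiOneOfOneDim_of_isCharPacket` (generic kit family), `not_isThetaFin_of_isCharPacket`, `not_isThetaFin_of_isOneDimH₀ (hμu) (h1 : IsOneDimH ρ)`,
plus Old→New ∕ New→Old `example`s.  CONSEQUENCE: the (T′) ∕ Thm. 13.3.7-at-the-record heads no longer depend on (ℓ8) at all — and (ℓ8) `h8` AT THE RECORD KIT is REFUTED for every CM `L`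
(S5-audit1 (g2) scratch c23d2e3a4e794d19 `not_forall_oneDimHLaw_record`, split-place witness `𝟙 ⊠ |det|_v`), so this matters: JQ-S5→S4-2 (the (R-a) `OneDimHLawU` twin, S4's ★ file) now
bites ONLY the EXISTENCE side `packetHOfOneDim h8 hunr ξ` and its read-backs (§1, §3, §4), consumed by S5-D alone; their U-twins `packetHOfOneDimU …` are ED. 2b (HEADS §2, after ★ W1–W3).
The ED. 1 (ℓ8)-bound theorems stay as typed: sound over an abstract `𝔩`, uninstantiable at `rogawskiLocalKit`.  S10-F ED. 2₀ may add `…₀` twins of its two heads calling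
`not_isThetaFin_of_isOneDimH₀ hμu h1` (S10's edition).  CARRIED AS HEADER LINES (S5-R5 (ii); no docstring edit of frozen decls): the kind-tag debt (R90-C14-audit1: support-style kind
tags for `MemOfRecord`, `LiftsToOfRecord`, `IsAPacketOfRecord`, `IsThetaFin`) and flags F1–F4 AS TYPED (F1 `IsAPacketOfRecord` kit-law-free — now load-bearing: 𝔊's A-packet notion and
its (T′) head are both (ℓ8)-free; F2 `gOfRecord_packetTrichotomy` by logic; F3 `IsThetaRegular := IsTheta`; F4 `pair := pairG` a parameter).
GREEN CONTRACT (ED. 2a): `lean check --json` rc 0, errors [], warnings [], sorries 0; `#print axioms` of each of the three §5 theorems = [propext, Classical.choice, Quot.sound].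
HONEST LABEL: ED. 2a removes a false-at-the-record hypothesis from the 13.3.7-at-the-record road and closes NO socket; HC_CM is proved only modulo the 7 printed citations
(2 remaining named inputs: hLiu418 = stmt-HodgeConjecture-24832, h413 = stmt-HodgeConjecture-24833) until rung 0 closes; count-neutral.
[cite: Rogawski1990, Thm. 13.3.6 (c) p. 202; §13.3 p. 203; §13.1 p. 199; §12.1 p. 171; §11.4 Prop. 11.4.1 (a) p. 166] [cite: BushnellHenniart2006, §9.1]
ED. 2b (S5 dealer RULING S5-R5 (g2) 2026-09-04T23:00:23Z (iii) «ROAD U = C2 ED. 2b LATER» ∕ 23:06:50Z (d); typist K2E1-typ1 (g2), HEADS `K2/K2E1-typ1/g2/HEADS-C2.ed2.md` 71579e5c9c52b019 §2;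
R-QS1-7: every ED. 1 and ED. 2a declaration AND docstring above and below is BYTE-FROZEN — this paragraph, ONE new `import` line (★ W3 `Theorems.R90S5SpectralPacketHOfOneDimU`,
which re-exports ★ W1 `Theorems.R90S4OneDimHLawU`; both tree-only, ★-accepted) and the trailing `section OneDimUDef` ∕ `section OneDimReadBacksU` (§6) are the only additions; NO
structure∕instance; ONE new `noncomputable def` (`packetHOfOneDimU`, a term of the existing structure `PacketHOfRecord`, no new predicate).
WHAT §6 ADDS AND WHY.  ED. 2a made the (T′)∕Thm. 13.3.7-at-the-record HEADS kit-law-free (§5); what still carried the REFUTED-at-the-record pin (ℓ8) `h8 : ∀ v, (𝔩 v).OneDimHLaw` was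
the EXISTENCE side — §1 `packetHOfOneDim h8 hunr ξ` and its read-backs §3–§4 (`_fin`, `_inf`, `memH_…_fin_loc`, `isOneDimH_…`, `isOneDimH_iff_eq_…`, `isAPacketOfRecord_iff_exists_…`,
`LiftsToOfRecord.loc_eq_xiH_rhoXi`, `not_isThetaFin_…`, `nHOfRecord_…`), consumed by S5-D (P3b) ∕ §4.1–§4.3.  §6 types their U-TWINS over the SATISFIABLE law (ℓ8ᵁ) `OneDimHLawU` (★ W1,
S4's (R-a) of JQ-S5→S4-2: «a UNITARIZABLE one-dimensional representation of `H_v` is an L-packet of cardinality one» — true at `rogawskiLocalKit`, where (ℓ8) fails at every split place on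
`𝟙 ⊠ |det|_v`): `packetHOfOneDimU 𝔩 𝔞 𝔞H μ₂ μ₁ archH h8U hunrU ξ := spectralPacketHOfOneDimU h8U ξ (archH (piTwoOfOneDim ξ) (chiOneOfOneDim ξ)) (hunrU ξ) (discH_shape_rhoXiU μ₂ μ₁ h8U archH ξ)`
(★ W3) and the nine read-backs `…U`, SAME SHAPE binder for binder (`h8 ↦ h8U`, `hunr ↦ hunrU` whose type mentions ★ `rhoXiU h8U ξ`), proofs token-for-token the ED. 1 proofs with the ★ U-names;
the (T′) twin `not_isThetaFin_packetHOfOneDimU` is §5's (ℓ8)-free head on `isOneDimH_packetHOfOneDimU`.  MONOTONICITY Old → New is a THEOREM, not a slogan: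
`packetHOfOneDimU … (fun v => (h8 v).toU) hunrU ξ = packetHOfOneDim … h8 hunr ξ` (★ `rhoXiU_toU_eq_rhoXi`), and an `example` transports `hunr` to `hunrU` along it.  CONSUMERS: S5-D ED. 4′
re-points (P3b) ∕ `pinMemA_ofRecord` ∕ §4.3 from `packetHOfOneDim h8 hunr` to `packetHOfOneDimU h8U hunrU` (typ2's∕p01's pen); S10-F needs nothing beyond ED. 2a.  Nothing of ED. 1∕2a is
deprecated: the (ℓ8)-bound decls stay sound over an abstract `𝔩`.
GREEN CONTRACT (ED. 2b): `lean check --json` rc 0, errors [], warnings [], sorries 0; `#print axioms` of `packetHOfOneDimU` and of each §6 theorem = [propext, Classical.choice, Quot.sound].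
HONEST LABEL: ED. 2b re-points the existence side of the 13.3.7-at-the-record road to a satisfiable kit law and closes NO socket; HC_CM is proved only modulo the 7 printed citations
(2 remaining named inputs: hLiu418 = stmt-HodgeConjecture-24832, h413 = stmt-HodgeConjecture-24833) until rung 0 closes; count-neutral.
[cite: Rogawski1990, §13.3 pp. 202–203; Thm. 13.3.7 pp. 202–203; §13.1 p. 199, Prop. 13.1.3 (d); §12.1 p. 171 type (3); §11.4 Prop. 11.4.1 (a) p. 166]
ED. 2c (S5 dealer R90-C133-plan (g2) DEAL BY NAME 2026-09-05T00:15:58Z «§7 S9 PAYERS IN C2's OWN CURRENCY»; typist K2E1-typ1 (g3) «S5∕typ1»; R-QS1-7: every ED. 1, ED. 2a and ED. 2b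
declaration AND docstring above and below is BYTE-FROZEN — this paragraph, ONE new `import` line (★ `Theorems.R90S5APacketGOfOneDimU`, R90-C133-p01 (g2) «S9-READERS (R-b)», which re-exports
★ p863407 `Theorems.R90S5XiHFibreOneDimU`; tree-only, ★-accepted) and the trailing `section S9Payers` (§7) are the only additions; NO structure ∕ instance ∕ predicate ∕ notation; ONE new
`noncomputable def` (V3 `aPacketOfRecordU`, a TERM of the existing carrier `PacketGOfRecord 𝔩 𝔞 μ Pk` = C ED. 4's ★ `HomogPacketG …`, hypotheses-first).
WHAT §7 ADDS AND WHY. ED. 2b handed the consumers the one-dimensional `ξ ∈ Π(H)` of record `packetHOfOneDimU h8U hunrU ξ` (existence side of the 13.3.7-at-the-record road, (ℓ8ᵁ)).  What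
S9-B's rows still lacked IN C2's CURRENCY (census R90-IF-p02 `CENSUS-S5rows`: rows `hlifts1` :304, `hn` :305, socket `sock_S9_xiReaders_cm`) were (a) the UNIQUENESS of the discrete
`H`-preimage of an A-packet — print «`Π̂(ξ) = {ξ} ∪ {1}`», `Card(Π̂) = 2`, hence `n(Π) = ½` on `Π_a` (p. 203; Thm. 13.3.4, Thm. 13.3.7; locally Prop. 13.1.2 (c) `ξ_H⁻¹(Π(ξ_v)) = {ξ_v}`) —
and (b) the A-packet `Π(ξ)` ITSELF as a packet of record with `IsAPacket Π(ξ) ∧ liftsTo ξ Π(ξ)` (p. 199 ¶2; p. 201 l. 16).  §7 types both over two ★ bricks of R90-C133-p01, HYPOTHESES-FIRST and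
positing nothing: (a) MODULO the kit law (ℓ-ξfib) `hfib : ∀ v, (𝔩 v).XiHFibreLawOneDim` («the `ξ_H`-fibre through a one-dimensional `H_v`-packet is a singleton», ★ p863407; S4's law row at
`rogawskiLocalKit`, JQ-S5→S4-8) — V1 `liftsToOfRecord_oneDim_unique` («`IsAPacketOfRecord Q → LiftsToOfRecord ρ Q → LiftsToOfRecord ρ′ Q → ρ = ρ′`», ★ `eq_of_isOneDimH_of_liftsTo_shape` at
the record's `DiscH` shape `fun _ _ h => h`) + reader V1′, V2 `eq_packetHOfOneDimU_of_liftsToOfRecord` (★ `eq_spectralPacketHOfOneDimU_of_forall_xiH_eq`, `hshape := ρ′.isDiscrete`), X1 `gOfRecord_lifts_eq_singleton`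
(row `hlifts1` verbatim: `(gOfRecord …).lifts Q = {ρ}`), X1′ `gOfRecord_cardHat_eq_two`, X2 `nGOfRecord_eq_half_of_isAPacketOfRecord` + reader X2′ `gOfRecord_n_eq_half_of_isAPacket` (row `hn`:
★ `n_eq_half_of_isOneDimH_of_liftsTo_shape` with `DiscH₁ :=` C's realisability predicate, `hd := discH_realised ρ₀`); (b) MODULO (ℓ8ᵁ) `h8U`, the unramifiedness datum `hunrU` (U1 :580
verbatim) and the two NAMED DEBT ROWS of ★ `aPacketGOfOneDimU` — (A-TOK) `hAtok : ∀ v, ξ_H((rhoXiU h8U ξ)_v) ∈ aTokOfRecord 𝔩 Pk v` (S4∕S7's law row, JQ-S5→S4-9) and (A-OCC)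
`hdisc : (Π(rhoXiU h8U ξ)).IsDiscrete μ` («some member of `Π(ξ)` occurs discretely», Thm. 13.3.6 (b): the 13.3.7 chain of S5-D ∕ S10-F) — V3 `aPacketOfRecordU 𝔩 𝔞 μ Pk h8U hunrU ξ hAtok hdisc
: PacketGOfRecord 𝔩 𝔞 μ Pk := aPacketGOfOneDimU h8U hunrU ξ (infOfOfRecord 𝔩 𝔞 μ) (aTokOfRecord 𝔩 Pk) hAtok hdisc` (+ `_eq`, `_fin_loc`, `rfl`), V4 `liftsToOfRecord_packetHOfOneDimU_aPacketOfRecordU`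
(placewise `rfl`), V5 `isAPacketOfRecord_aPacketOfRecordU`, V6 `eq_aPacketOfRecordU_of_liftsToOfRecord` (★ `eq_aPacketGOfOneDimU_of_liftsTo_shape`: `Π(ξ)` is the only packet of record to which
`ξ`'s packet lifts), V7 ∕ V7′ ∕ V7″ the `gOfRecord`-level readers `gOfRecord_IsAPacket_aPacketOfRecordU`, `gOfRecord_liftsTo_packetHOfOneDimU_aPacketOfRecordU`,
`gOfRecord_exists_isAPacket_and_liftsTo_packetHOfOneDimU` (the `∃ Pξ, IsAPacket Pξ ∧ liftsTo ρ Pξ` conjunct of `sock_S9_xiReaders_cm` at `ρ := packetHOfOneDimU … ξ`), V8 ∕ V8′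
`nGOfRecord_aPacketOfRecordU`, `gOfRecord_n_aPacketOfRecordU` (`= 1∕2`).  The `gOfRecord`-level readers (V1′ `gOfRecord_liftsTo_unique_of_isAPacket` = `sock_S9_lifts1_cm` verbatim, X1, X1′, X2′,
V7–V8′) take their binders in `𝔊`-currency (`(gOfRecord …).Packet` ∕ `.PacketH`, `rfl`-equal to `PacketGOfRecord …` ∕ `PacketHOfRecord …`) so that S9's `{ξ} : Set X.G.PacketH` matches syntactically.  No (ℓ8)-twins are typed (cf. ED. 2b).
GREEN CONTRACT (ED. 2c): `lean check --json` rc 0, errors [], warnings [], sorries 0; `#print axioms` of `aPacketOfRecordU` and of every §7 theorem = [propext, Classical.choice, Quot.sound].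
HONEST LABEL: ED. 2c closes NO socket — every §7 row is modulo (ℓ8ᵁ) + (ℓ-ξfib) ∕ (A-TOK) ∕ (A-OCC) exactly as its binders name them, whose payers are S4∕S7 (`rogawskiLocalKit` law rows) and
the 13.3.7 chain (S5-D ∕ S10-F); HC_CM is proved only modulo the 7 printed citations (2 remaining named inputs: hLiu418 = stmt-HodgeConjecture-24832, h413 = stmt-HodgeConjecture-24833) until
rung 0 closes; count-neutral.
[cite: Rogawski1990, §13.3 p. 201 ll. 10–18, Thm. 13.3.4 p. 202, Thm. 13.3.5 p. 202, Thm. 13.3.6 (b) p. 202, Thm. 13.3.7 pp. 202–203, p. 203; §13.1 Prop. 13.1.2 (c) p. 198, p. 199 ¶2, Prop. 13.1.3 (d) p. 199; §13.2 p. 200]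
-/

set_option autoImplicit false
set_option linter.dupNamespace false

open NumberField IsDedekindDomain MeasureTheory Filter
open scoped Matrix MatrixGroups

namespace Summit.HodgeConjecture.HodgeConjecture.R90.S5

open Literature.NumberTheory Literature.NumberTheory.Automorphic Literature.NumberTheory.Automorphic.UnitaryGroup
open Literature.NumberTheory.Rogawski1990 Literature.NumberTheory.GaloisRepresentations
open Summit.HodgeConjecture.HodgeConjecture.Cruxes.H413
open Summit.HodgeConjecture.HodgeConjecture.Cruxes.H413.F0P3LocalPacketKit
open Summit.HodgeConjecture.HodgeConjecture.Cruxes.H413.F0P3GlobalPacket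
open Summit.HodgeConjecture.HodgeConjecture.Cruxes.H413.F0P3GlobalPacketDiscrete
open Summit.HodgeConjecture.HodgeConjecture.Cruxes.H413.F0P3ArchPacketKit
open Summit.HodgeConjecture.HodgeConjecture.Cruxes.H413.F0P3SpectralPacket
open Summit.HodgeConjecture.HodgeConjecture.Cruxes.H413.F0P3InnerFormClassificationV6 (TestG TestH splitForm)
open Summit.HodgeConjecture.HodgeConjecture.Cruxes.H413.K2E1SpectralTermsDiscreteHalf (DiscreteClass)

variable {L : Type} [Field L] [NumberField L] [IsCMField L]

/-- FORM NOTE: S10's `qsForm L` IS C's `splitForm L 3` (both the antidiagonal `Matrix.of` abbrev), `rfl`. [cite: Rogawski1990, §13.3 p. 201] -/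
theorem qsForm_eq_splitForm (L : Type) [Field L] [NumberField L] [IsCMField L] : qsForm L = splitForm L 3 := rfl

/-! ## §1 The predicates of record (each a `def … : Prop`, parameters explicit; bodies BY ★ NAME) -/

section Predicates

variable (𝔩 : ∀ v : HeightOneSpectrum (𝓞 ↥(maximalRealSubfield L)), LocalPacketKit L (splitForm L 3) v) (𝔞 : ArchPacketKit) (𝔞H : ArchPacketKitH 𝔞)
  (μ : Measure (adelicGroupData (↥(maximalRealSubfield L)) L (IsCMField.complexConj L) 3 (splitForm L 3)).automorphicQuotient)
  [(adelicGroupData (↥(maximalRealSubfield L)) L (IsCMField.complexConj L) 3 (splitForm L 3)).IsAutomorphicMeasure μ]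
  (μ₂ : Measure (adelicGroupData (↥(maximalRealSubfield L)) L (IsCMField.complexConj L) 2 (Φ L 2)).automorphicQuotient)
  [(adelicGroupData (↥(maximalRealSubfield L)) L (IsCMField.complexConj L) 2 (Φ L 2)).IsAutomorphicMeasure μ₂]
  (μ₁ : Measure (adelicGroupData (↥(maximalRealSubfield L)) L (IsCMField.complexConj L) 1 (Φ L 1)).automorphicQuotient)
  [(adelicGroupData (↥(maximalRealSubfield L)) L (IsCMField.complexConj L) 1 (Φ L 1)).IsAutomorphicMeasure μ₁]
  (archH : (∀ v : HeightOneSpectrum (𝓞 ↥(maximalRealSubfield L)), IrrClass ((cmDatum L 2 (Φ L 2)).Local v)) →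
    (∀ v : HeightOneSpectrum (𝓞 ↥(maximalRealSubfield L)), ((cmDatum L 1 (Φ L 1)).Local v) →* ℂˣ) → 𝔞H.PktInfH)

/-- **`MemOfRecord 𝔩 𝔞 μ Pk c Q` — «the discrete class `c` is a MEMBER of the packet `Q`»**, UNIVERSAL OVER REPRESENTATIVES (dealer JQ-2): for every discrete `P` of class
`c`, every `v`-constituent `c′` of `P` (★ D6 currency: `IrrClass.comap (localPiEquiv … v) c′` is a constituent of the smooth part of `P|_{U(Φ₃)(𝔸_f)}` along ★ `inclPlace v` —
the antecedent of pin (P4) `hPin_memA` of ★ `xiRigiditySharpQsAt_of_memLaw_of_pins`, token for token) lies in the local packet `Q_v` («`π = ⊗ π_v` such that `π_v ∈ Π_v` for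
all `v`», p. 201 ¶2).  No quotient-lift lemma is needed to instantiate it at `c := DiscreteClass.mk P` (`MemOfRecord.apply_mk`). [cite: Rogawski1990, §13.3 p. 201 ¶2] [cite: FlathCorvallis1979, Thm. 3] -/
def MemOfRecord [Nonempty 𝔞.PktInf] (Pk : OneDimAutRepH L → ∀ v : HeightOneSpectrum (𝓞 ↥(maximalRealSubfield L)), CMLocalAPacket L (splitForm L 3) v)
    (c : DiscreteClass (adelicGroupData (↥(maximalRealSubfield L)) L (IsCMField.complexConj L) 3 (splitForm L 3)) μ) (Q : PacketGOfRecord 𝔩 𝔞 μ Pk) : Prop :=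
  ∀ P : DiscreteAutomorphicRep (adelicGroupData (↥(maximalRealSubfield L)) L (IsCMField.complexConj L) 3 (splitForm L 3)) μ, DiscreteClass.mk P = c →
    ∀ (v : HeightOneSpectrum (𝓞 ↥(maximalRealSubfield L))) (c' : IrrClass ((cmDatum L 3 (splitForm L 3)).Local v)),
      (IrrClass.comap (localPiEquiv L (IsCMField.complexConj L) 3 (splitForm L 3) v) c').IsConstituentOf
          (P.finRep.smoothPart.toRepresentation.comp (inclPlace (↥(maximalRealSubfield L)) L (IsCMField.complexConj L) 3 (splitForm L 3) v)) →
      c' ∈ (𝔩 v).mem (Q.1.fin.loc v)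

/-- **`LiftsToOfRecord … ρ Q` — «`Π = Π(ρ)`»**: placewise, the local packet `Q_v` is the kit's endoscopic transfer `ξ_H(ρ_v)` (★ `LocalPacketKit.xiH : PktH → Pkt`) of `ρ_v`
(dealer J3-R4 AMENDED 16:42:37Z). [cite: Rogawski1990, §13.3 p. 201 ll. 16–18; §13.1 p. 199] -/
def LiftsToOfRecord [Nonempty 𝔞.PktInf] (Pk : OneDimAutRepH L → ∀ v : HeightOneSpectrum (𝓞 ↥(maximalRealSubfield L)), CMLocalAPacket L (splitForm L 3) v)
    (ρ : PacketHOfRecord 𝔩 𝔞 𝔞H μ₂ μ₁ archH) (Q : PacketGOfRecord 𝔩 𝔞 μ Pk) : Prop :=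
  ∀ v : HeightOneSpectrum (𝓞 ↥(maximalRealSubfield L)), Q.1.fin.loc v = (𝔩 v).xiH (ρ.fin.loc v)

/-- **`IsAPacketOfRecord … Q` — «`Q ∈ Π_a(G) = {Π(ξ) : ξ ∈ Π(H), dim ξ = 1}`»** (p. 201 l. 16, VERBATIM): `Q` is the lift of SOME one-dimensional discrete `H`-packet of record
(★ p862138 `IsOneDimH`, kit-law-free).  Under (ℓ8) this is «`∃ ξ, LiftsToOfRecord (packetHOfOneDim … ξ) Q`» (`isAPacketOfRecord_iff_exists_packetHOfOneDim`, §3). [cite: Rogawski1990, §13.3 p. 201 l. 16; Thm. 13.3.7 pp. 202–203] -/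
def IsAPacketOfRecord [Nonempty 𝔞.PktInf] (Pk : OneDimAutRepH L → ∀ v : HeightOneSpectrum (𝓞 ↥(maximalRealSubfield L)), CMLocalAPacket L (splitForm L 3) v)
    (Q : PacketGOfRecord 𝔩 𝔞 μ Pk) : Prop :=
  ∃ ρ : PacketHOfRecord 𝔩 𝔞 𝔞H μ₂ μ₁ archH, IsOneDimH ρ ∧ LiftsToOfRecord 𝔩 𝔞 𝔞H μ μ₂ μ₁ archH Pk ρ Q

/-- **`IsThetaFin 𝔩 μ₂ μ₁ μω σ` — «the finite `H`-packet family `σ` is (realised by) a θ-LIFT `ρ(θ)`, θ REGULAR»**: some realising pair `(π₂, χ₁)` of `σ` (C §1 ★ `IsRealisedH`)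
has its `U(Φ₂)`-string `π₂` of the form of record ★ p861825 `R90.S5.IsThetaOfRecord L μω π₂` (dealer JQ-4 «=», the `π₂`-string reading). [cite: Rogawski1990, §13.3 p. 203; §11.4 Prop. 11.4.1 p. 166; §12.1 p. 171] -/
def IsThetaFin (μω : HeckeCharacter L) (σ : GlobalPacketH 𝔩) : Prop :=
  ∃ (π₂ : ∀ v : HeightOneSpectrum (𝓞 ↥(maximalRealSubfield L)), IrrClass ((cmDatum L 2 (Φ L 2)).Local v))
    (χ₁ : ∀ v : HeightOneSpectrum (𝓞 ↥(maximalRealSubfield L)), ((cmDatum L 1 (Φ L 1)).Local v) →* ℂˣ)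
    (hχ₁ : ∀ v : HeightOneSpectrum (𝓞 ↥(maximalRealSubfield L)),
      IsOpen (((χ₁ v).ker : Subgroup ((cmDatum L 1 (Φ L 1)).Local v)) : Set ((cmDatum L 1 (Φ L 1)).Local v))),
    IsRealisedH 𝔩 μ₂ μ₁ σ π₂ χ₁ hχ₁ ∧ R90.S5.IsThetaOfRecord L μω π₂

/-- **`packetHOfOneDim … h8 hunr ξ` — THE ONE-DIMENSIONAL `ξ ∈ Π(H)` AS A DISCRETE `H`-PACKET OF RECORD, CLOSED** (dealer «JQ-9 SETTLED», K2E1-p12 ★ p862138): finite part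
★ `GlobalPacketH.rhoXi h8 ξ` (singleton packets `{⟦ξ_v⟧}` under (ℓ8) `OneDimHLaw`), archimedean packet `archH` OF ITS OWN REALISING PAIR `(piTwoOfOneDim ξ, chiOneOfOneDim ξ)`,
discreteness of record = ★ `discH_shape_rhoXi` (occurrence of `ξ₂ ∘ det₀` and `ξ₁` PROVED there, not posited).  Binders: `h8` (ℓ8 pin), `hunr` (cofinite unramifiedness of
`ξ_H(ξ_v)` — a fact about the kit's data, honest). [cite: Rogawski1990, §13.3 pp. 202–203; §12.1 p. 171; §13.1 p. 199] -/
noncomputable def packetHOfOneDim (h8 : ∀ v : HeightOneSpectrum (𝓞 ↥(maximalRealSubfield L)), (𝔩 v).OneDimHLaw)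
    (hunr : ∀ ξ : OneDimAutRepH L, ∀ᶠ v : HeightOneSpectrum (𝓞 ↥(maximalRealSubfield L)) in cofinite,
      (𝔩 v).unr ((𝔩 v).xiH ((GlobalPacketH.rhoXi h8 ξ).loc v)))
    (ξ : OneDimAutRepH L) : PacketHOfRecord 𝔩 𝔞 𝔞H μ₂ μ₁ archH :=
  spectralPacketHOfOneDim h8 ξ (archH (piTwoOfOneDim ξ) (chiOneOfOneDim ξ)) (hunr ξ) (discH_shape_rhoXi μ₂ μ₁ h8 archH ξ)

end Predicates

/-! ## §2 The term `gOfRecord : GlobalPacketData (TestG L) (TestH L)` [§13.3 pp. 201–203] -/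

section Datum

variable (𝔩 : ∀ v : HeightOneSpectrum (𝓞 ↥(maximalRealSubfield L)), LocalPacketKit L (splitForm L 3) v) (𝔞 : ArchPacketKit) (𝔞H : ArchPacketKitH 𝔞)
  (μ : Measure (adelicGroupData (↥(maximalRealSubfield L)) L (IsCMField.complexConj L) 3 (splitForm L 3)).automorphicQuotient)
  [(adelicGroupData (↥(maximalRealSubfield L)) L (IsCMField.complexConj L) 3 (splitForm L 3)).IsAutomorphicMeasure μ]
  (μ₂ : Measure (adelicGroupData (↥(maximalRealSubfield L)) L (IsCMField.complexConj L) 2 (Φ L 2)).automorphicQuotient)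
  [(adelicGroupData (↥(maximalRealSubfield L)) L (IsCMField.complexConj L) 2 (Φ L 2)).IsAutomorphicMeasure μ₂]
  (μ₁ : Measure (adelicGroupData (↥(maximalRealSubfield L)) L (IsCMField.complexConj L) 1 (Φ L 1)).automorphicQuotient)
  [(adelicGroupData (↥(maximalRealSubfield L)) L (IsCMField.complexConj L) 1 (Φ L 1)).IsAutomorphicMeasure μ₁]
  (archH : (∀ v : HeightOneSpectrum (𝓞 ↥(maximalRealSubfield L)), IrrClass ((cmDatum L 2 (Φ L 2)).Local v)) →
    (∀ v : HeightOneSpectrum (𝓞 ↥(maximalRealSubfield L)), ((cmDatum L 1 (Φ L 1)).Local v) →* ℂˣ) → 𝔞H.PktInfH)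
  [Nonempty 𝔞.PktInf] (Pk : OneDimAutRepH L → ∀ v : HeightOneSpectrum (𝓞 ↥(maximalRealSubfield L)), CMLocalAPacket L (splitForm L 3) v)
  (μω : HeckeCharacter L)
  (pairG : Option (PacketHOfRecord 𝔩 𝔞 𝔞H μ₂ μ₁ archH) →
    DiscreteClass (adelicGroupData (↥(maximalRealSubfield L)) L (IsCMField.complexConj L) 3 (splitForm L 3)) μ → ℂ)

/-- **`gOfRecord … : GlobalPacketData (TestG L) (TestH L)` — THE `𝔊` OF RECORD** (S10-F's `TwistedComparisonData.𝔊`): the fifteen fields of ★ `GlobalPacketData` at the S5 objects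
of record (module docstring table), every kit ∕ measure ∕ datum a PARAMETER; `pair := pairG` is a parameter outright (dealer JQ-6). [cite: Rogawski1990, §13.3 pp. 201–203, Thm. 13.3.7 pp. 202–203; §13.6 (13.6.1) p. 208] -/
noncomputable def gOfRecord : GlobalPacketData.{0} (TestG L) (TestH L) where
  Rep := DiscreteClass (adelicGroupData (↥(maximalRealSubfield L)) L (IsCMField.complexConj L) 3 (splitForm L 3)) μ
  m := fun c => c.mult.toNat
  Packet := PacketGOfRecord 𝔩 𝔞 μ Pk
  mem := MemOfRecord 𝔩 𝔞 μ Pk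
  IsStable := fun Q => ¬ ∃ ρ : PacketHOfRecord 𝔩 𝔞 𝔞H μ₂ μ₁ archH, LiftsToOfRecord 𝔩 𝔞 𝔞H μ μ₂ μ₁ archH Pk ρ Q
  IsEndoscopic := fun Q => (∃ ρ : PacketHOfRecord 𝔩 𝔞 𝔞H μ₂ μ₁ archH, LiftsToOfRecord 𝔩 𝔞 𝔞H μ μ₂ μ₁ archH Pk ρ Q) ∧ ¬ IsAPacketOfRecord 𝔩 𝔞 𝔞H μ μ₂ μ₁ archH Pk Q
  IsAPacket := IsAPacketOfRecord 𝔩 𝔞 𝔞H μ μ₂ μ₁ archH Pk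
  PacketH := PacketHOfRecord 𝔩 𝔞 𝔞H μ₂ μ₁ archH
  IsTheta := fun ρ => IsThetaFin 𝔩 μ₂ μ₁ μω ρ.fin
  IsThetaRegular := fun ρ => IsThetaFin 𝔩 μ₂ μ₁ μω ρ.fin
  liftsTo := LiftsToOfRecord 𝔩 𝔞 𝔞H μ μ₂ μ₁ archH Pk
  pair := pairG
  n := nGOfRecord 𝔩 𝔞 μ μ₂ μ₁ Pk
  nH := nHOfRecord (IsThetaFin 𝔩 μ₂ μ₁ μω)

/-! ### §2.1 Field read-backs (`rfl`) -/

/-- `Rep` of record = ★ E1 `DiscreteClass` on `U(Φ₃)`. [cite: Rogawski1990, §13.6 (13.6.1) p. 208] -/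
theorem gOfRecord_Rep : (gOfRecord 𝔩 𝔞 𝔞H μ μ₂ μ₁ archH Pk μω pairG).Rep =
    DiscreteClass (adelicGroupData (↥(maximalRealSubfield L)) L (IsCMField.complexConj L) 3 (splitForm L 3)) μ := rfl

/-- `m` of record = `(mult c).toNat`. [cite: Rogawski1990, §13.3 Thm. 13.3.1 p. 201; §13.6 (13.6.1) p. 208] -/
theorem gOfRecord_m (c : DiscreteClass (adelicGroupData (↥(maximalRealSubfield L)) L (IsCMField.complexConj L) 3 (splitForm L 3)) μ) :
    (gOfRecord 𝔩 𝔞 𝔞H μ μ₂ μ₁ archH Pk μω pairG).m c = c.mult.toNat := rfl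

/-- `Packet` of record = C ED. 4 `PacketGOfRecord 𝔩 𝔞 μ Pk`. [cite: Rogawski1990, §13.3 p. 201 ll. 16–18] -/
theorem gOfRecord_Packet : (gOfRecord 𝔩 𝔞 𝔞H μ μ₂ μ₁ archH Pk μω pairG).Packet = PacketGOfRecord 𝔩 𝔞 μ Pk := rfl

/-- `PacketH` of record = C `PacketHOfRecord …`. [cite: Rogawski1990, §13.3 p. 202] -/
theorem gOfRecord_PacketH : (gOfRecord 𝔩 𝔞 𝔞H μ μ₂ μ₁ archH Pk μω pairG).PacketH = PacketHOfRecord 𝔩 𝔞 𝔞H μ₂ μ₁ archH := rfl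

/-- `mem` of record unfolds to `MemOfRecord`. [cite: Rogawski1990, §13.3 p. 201 ¶2] -/
theorem gOfRecord_mem (c : DiscreteClass (adelicGroupData (↥(maximalRealSubfield L)) L (IsCMField.complexConj L) 3 (splitForm L 3)) μ) (Q : PacketGOfRecord 𝔩 𝔞 μ Pk) :
    (gOfRecord 𝔩 𝔞 𝔞H μ μ₂ μ₁ archH Pk μω pairG).mem c Q = MemOfRecord 𝔩 𝔞 μ Pk c Q := rfl

/-- `liftsTo` of record unfolds to `LiftsToOfRecord`. [cite: Rogawski1990, §13.3 p. 201 ll. 16–18] -/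
theorem gOfRecord_liftsTo (ρ : PacketHOfRecord 𝔩 𝔞 𝔞H μ₂ μ₁ archH) (Q : PacketGOfRecord 𝔩 𝔞 μ Pk) :
    (gOfRecord 𝔩 𝔞 𝔞H μ μ₂ μ₁ archH Pk μω pairG).liftsTo ρ Q = LiftsToOfRecord 𝔩 𝔞 𝔞H μ μ₂ μ₁ archH Pk ρ Q := rfl

/-- `IsAPacket` of record unfolds to `IsAPacketOfRecord`. [cite: Rogawski1990, §13.3 p. 201 l. 16] -/
theorem gOfRecord_IsAPacket (Q : PacketGOfRecord 𝔩 𝔞 μ Pk) :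
    (gOfRecord 𝔩 𝔞 𝔞H μ μ₂ μ₁ archH Pk μω pairG).IsAPacket Q = IsAPacketOfRecord 𝔩 𝔞 𝔞H μ μ₂ μ₁ archH Pk Q := rfl

/-- `IsStable` of record: no `ρ ∈ Π(H)` lifts to `Q`. [cite: Rogawski1990, §13.3 p. 201 ll. 17–18] -/
theorem gOfRecord_IsStable (Q : PacketGOfRecord 𝔩 𝔞 μ Pk) :
    (gOfRecord 𝔩 𝔞 𝔞H μ μ₂ μ₁ archH Pk μω pairG).IsStable Q = ¬ ∃ ρ : PacketHOfRecord 𝔩 𝔞 𝔞H μ₂ μ₁ archH, LiftsToOfRecord 𝔩 𝔞 𝔞H μ μ₂ μ₁ archH Pk ρ Q := rfl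

/-- `IsEndoscopic` of record: some `ρ` lifts to `Q` and `Q ∉ Π_a`. [cite: Rogawski1990, §13.3 p. 201 l. 17, Thm. 13.3.2 p. 201] -/
theorem gOfRecord_IsEndoscopic (Q : PacketGOfRecord 𝔩 𝔞 μ Pk) :
    (gOfRecord 𝔩 𝔞 𝔞H μ μ₂ μ₁ archH Pk μω pairG).IsEndoscopic Q =
      ((∃ ρ : PacketHOfRecord 𝔩 𝔞 𝔞H μ₂ μ₁ archH, LiftsToOfRecord 𝔩 𝔞 𝔞H μ μ₂ μ₁ archH Pk ρ Q) ∧ ¬ IsAPacketOfRecord 𝔩 𝔞 𝔞H μ μ₂ μ₁ archH Pk Q) := rfl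

/-- `IsTheta` of record = `IsThetaFin` of the finite part. [cite: Rogawski1990, §13.3 p. 203] -/
theorem gOfRecord_IsTheta (ρ : PacketHOfRecord 𝔩 𝔞 𝔞H μ₂ μ₁ archH) :
    (gOfRecord 𝔩 𝔞 𝔞H μ μ₂ μ₁ archH Pk μω pairG).IsTheta ρ = IsThetaFin 𝔩 μ₂ μ₁ μω ρ.fin := rfl

/-- `IsThetaRegular` of record = `IsTheta` of record (regularity `θ₁ ≠ θ₃` is inside ★ `IsThetaOfRecord`). [cite: Rogawski1990, §13.3 p. 203] -/
theorem gOfRecord_IsThetaRegular (ρ : PacketHOfRecord 𝔩 𝔞 𝔞H μ₂ μ₁ archH) :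
    (gOfRecord 𝔩 𝔞 𝔞H μ μ₂ μ₁ archH Pk μω pairG).IsThetaRegular ρ = IsThetaFin 𝔩 μ₂ μ₁ μω ρ.fin := rfl

/-- `pair` of record = the parameter `pairG`. [cite: Rogawski1990, §13.3 Thm. 13.3.7 pp. 202–203] -/
theorem gOfRecord_pair : (gOfRecord 𝔩 𝔞 𝔞H μ μ₂ μ₁ archH Pk μω pairG).pair = pairG := rfl

/-- `n` of record = C ED. 4 `nGOfRecord`. [cite: Rogawski1990, §13.3 Thm. 13.3.7 pp. 202–203] -/
theorem gOfRecord_n (Q : PacketGOfRecord 𝔩 𝔞 μ Pk) :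
    (gOfRecord 𝔩 𝔞 𝔞H μ μ₂ μ₁ archH Pk μω pairG).n Q = nGOfRecord 𝔩 𝔞 μ μ₂ μ₁ Pk Q := rfl

/-- `nH` of record = C `nHOfRecord (IsThetaFin …)` (`½` on θ-lifts, `1` otherwise). [cite: Rogawski1990, §13.3 p. 203] -/
theorem gOfRecord_nH (ρ : PacketHOfRecord 𝔩 𝔞 𝔞H μ₂ μ₁ archH) :
    (gOfRecord 𝔩 𝔞 𝔞H μ μ₂ μ₁ archH Pk μω pairG).nH ρ = nHOfRecord (IsThetaFin 𝔩 μ₂ μ₁ μω) ρ := rfl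

/-! ### §2.2 `PacketTrichotomy` at the record — pure logic at these bodies [Thm. 13.3.5 p. 202] -/

/-- **★ `PacketTrichotomy` HOLDS FOR `gOfRecord` BY LOGIC**: with `Π_s := lifts from no ρ`, `Π_e := lifts from some ρ ∧ ∉ Π_a`, `Π_a ⊆ lifts from some ρ`, every packet is of
exactly one kind.  (Print's content in Thm. 13.3.5 — rigidity «`Π_v = Π′_v` a.a. `v` ⇒ `Π = Π′`» and cuspidality of the endoscopic `ρ` — lives in the coherence of
`PacketGOfRecord` and in Thm. 13.3.2, not in this disjoint-union statement.) [cite: Rogawski1990, §13.3 Thm. 13.3.5 p. 202, p. 201 ll. 16–18] -/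
theorem gOfRecord_packetTrichotomy : (gOfRecord 𝔩 𝔞 𝔞H μ μ₂ μ₁ archH Pk μω pairG).PacketTrichotomy := by
  intro Q
  by_cases hA : IsAPacketOfRecord 𝔩 𝔞 𝔞H μ μ₂ μ₁ archH Pk Q
  · refine Or.inr (Or.inr ⟨?_, ?_, hA⟩)
    · obtain ⟨ρ, -, hρ⟩ := hA
      exact fun h => h ⟨ρ, hρ⟩
    · exact fun h => h.2 hA
  · by_cases hL : ∃ ρ : PacketHOfRecord 𝔩 𝔞 𝔞H μ₂ μ₁ archH, LiftsToOfRecord 𝔩 𝔞 𝔞H μ μ₂ μ₁ archH Pk ρ Q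
    · exact Or.inr (Or.inl ⟨fun h => h hL, ⟨hL, hA⟩, hA⟩)
    · exact Or.inl ⟨hL, fun h => hL h.1, hA⟩

end Datum

/-! ## §3 Read-backs the consumers need (no content: unfoldings, ext, functionality, (P4) instantiation, the one-dimensional read-back under (ℓ8)) -/

section ReadBacks

variable {𝔩 : ∀ v : HeightOneSpectrum (𝓞 ↥(maximalRealSubfield L)), LocalPacketKit L (splitForm L 3) v} {𝔞 : ArchPacketKit} {𝔞H : ArchPacketKitH 𝔞}
  {μ : Measure (adelicGroupData (↥(maximalRealSubfield L)) L (IsCMField.complexConj L) 3 (splitForm L 3)).automorphicQuotient}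
  [(adelicGroupData (↥(maximalRealSubfield L)) L (IsCMField.complexConj L) 3 (splitForm L 3)).IsAutomorphicMeasure μ]
  {μ₂ : Measure (adelicGroupData (↥(maximalRealSubfield L)) L (IsCMField.complexConj L) 2 (Φ L 2)).automorphicQuotient}
  [(adelicGroupData (↥(maximalRealSubfield L)) L (IsCMField.complexConj L) 2 (Φ L 2)).IsAutomorphicMeasure μ₂]
  {μ₁ : Measure (adelicGroupData (↥(maximalRealSubfield L)) L (IsCMField.complexConj L) 1 (Φ L 1)).automorphicQuotient}
  [(adelicGroupData (↥(maximalRealSubfield L)) L (IsCMField.complexConj L) 1 (Φ L 1)).IsAutomorphicMeasure μ₁]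
  {archH : (∀ v : HeightOneSpectrum (𝓞 ↥(maximalRealSubfield L)), IrrClass ((cmDatum L 2 (Φ L 2)).Local v)) →
    (∀ v : HeightOneSpectrum (𝓞 ↥(maximalRealSubfield L)), ((cmDatum L 1 (Φ L 1)).Local v) →* ℂˣ) → 𝔞H.PktInfH}
  {Pk : OneDimAutRepH L → ∀ v : HeightOneSpectrum (𝓞 ↥(maximalRealSubfield L)), CMLocalAPacket L (splitForm L 3) v}

/-- Unfolding of `MemOfRecord`. [cite: Rogawski1990, §13.3 p. 201 ¶2] -/
theorem memOfRecord_iff [Nonempty 𝔞.PktInf] (c : DiscreteClass (adelicGroupData (↥(maximalRealSubfield L)) L (IsCMField.complexConj L) 3 (splitForm L 3)) μ) (Q : PacketGOfRecord 𝔩 𝔞 μ Pk) :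
    MemOfRecord 𝔩 𝔞 μ Pk c Q ↔
      ∀ P : DiscreteAutomorphicRep (adelicGroupData (↥(maximalRealSubfield L)) L (IsCMField.complexConj L) 3 (splitForm L 3)) μ, DiscreteClass.mk P = c →
        ∀ (v : HeightOneSpectrum (𝓞 ↥(maximalRealSubfield L))) (c' : IrrClass ((cmDatum L 3 (splitForm L 3)).Local v)),
          (IrrClass.comap (localPiEquiv L (IsCMField.complexConj L) 3 (splitForm L 3) v) c').IsConstituentOf
              (P.finRep.smoothPart.toRepresentation.comp (inclPlace (↥(maximalRealSubfield L)) L (IsCMField.complexConj L) 3 (splitForm L 3) v)) →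
          c' ∈ (𝔩 v).mem (Q.1.fin.loc v) :=
  Iff.rfl

/-- **(P4) INSTANTIATION AT `cls := DiscreteClass.mk P`, by `rfl`**: membership of the class of `P` gives membership of every `v`-constituent of `P` itself.
[cite: Rogawski1990, §13.3 p. 201 ¶2] [cite: FlathCorvallis1979, Thm. 3] -/
theorem MemOfRecord.apply_mk [Nonempty 𝔞.PktInf] {P : DiscreteAutomorphicRep (adelicGroupData (↥(maximalRealSubfield L)) L (IsCMField.complexConj L) 3 (splitForm L 3)) μ}
    {Q : PacketGOfRecord 𝔩 𝔞 μ Pk} (h : MemOfRecord 𝔩 𝔞 μ Pk (DiscreteClass.mk P) Q)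
    (v : HeightOneSpectrum (𝓞 ↥(maximalRealSubfield L))) (c' : IrrClass ((cmDatum L 3 (splitForm L 3)).Local v))
    (hc' : (IrrClass.comap (localPiEquiv L (IsCMField.complexConj L) 3 (splitForm L 3) v) c').IsConstituentOf
      (P.finRep.smoothPart.toRepresentation.comp (inclPlace (↥(maximalRealSubfield L)) L (IsCMField.complexConj L) 3 (splitForm L 3) v))) :
    c' ∈ (𝔩 v).mem (Q.1.fin.loc v) :=
  h P rfl v c' hc'

/-- Unfolding of `LiftsToOfRecord`. [cite: Rogawski1990, §13.3 p. 201 ll. 16–18] -/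
theorem liftsToOfRecord_iff [Nonempty 𝔞.PktInf] (ρ : PacketHOfRecord 𝔩 𝔞 𝔞H μ₂ μ₁ archH) (Q : PacketGOfRecord 𝔩 𝔞 μ Pk) :
    LiftsToOfRecord 𝔩 𝔞 𝔞H μ μ₂ μ₁ archH Pk ρ Q ↔ ∀ v : HeightOneSpectrum (𝓞 ↥(maximalRealSubfield L)), Q.1.fin.loc v = (𝔩 v).xiH (ρ.fin.loc v) :=
  Iff.rfl

/-- **(P4) ROAD, COMPOSED**: `mem (mk P) Q` and `Q = Π(ρ)` put every `v`-constituent of `P` in the kit fibre `(𝔩 v).mem (ξ_H(ρ_v))` — the input of K2E3-p21's DEAL #21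
`mem_xiH_rogawskiLocalKit_of_oneDim` (R90-C133-p01's 4-lemma ★ chain 16:43:46Z). [cite: Rogawski1990, §13.3 p. 201; §13.1 p. 199; Prop. 13.1.3 (d) p. 199] -/
theorem MemOfRecord.mem_xiH_of_liftsTo [Nonempty 𝔞.PktInf] {P : DiscreteAutomorphicRep (adelicGroupData (↥(maximalRealSubfield L)) L (IsCMField.complexConj L) 3 (splitForm L 3)) μ}
    {Q : PacketGOfRecord 𝔩 𝔞 μ Pk} {ρ : PacketHOfRecord 𝔩 𝔞 𝔞H μ₂ μ₁ archH}
    (h : MemOfRecord 𝔩 𝔞 μ Pk (DiscreteClass.mk P) Q) (hl : LiftsToOfRecord 𝔩 𝔞 𝔞H μ μ₂ μ₁ archH Pk ρ Q)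
    (v : HeightOneSpectrum (𝓞 ↥(maximalRealSubfield L))) (c' : IrrClass ((cmDatum L 3 (splitForm L 3)).Local v))
    (hc' : (IrrClass.comap (localPiEquiv L (IsCMField.complexConj L) 3 (splitForm L 3) v) c').IsConstituentOf
      (P.finRep.smoothPart.toRepresentation.comp (inclPlace (↥(maximalRealSubfield L)) L (IsCMField.complexConj L) 3 (splitForm L 3) v))) :
    c' ∈ (𝔩 v).mem ((𝔩 v).xiH (ρ.fin.loc v)) :=
  hl v ▸ h.apply_mk v c' hc'

/-- Two finite packet families with the same local packets are equal (structure eta; `cofinite_unr` is a proof). [cite: Rogawski1990, §13.3 p. 201 ¶2] -/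
theorem globalPacket_ext {Pg Pg' : GlobalPacket 𝔩} (h : ∀ v : HeightOneSpectrum (𝓞 ↥(maximalRealSubfield L)), Pg.loc v = Pg'.loc v) : Pg = Pg' := by
  obtain ⟨loc, hloc⟩ := Pg
  obtain ⟨loc', hloc'⟩ := Pg'
  obtain rfl : loc = loc' := funext h
  rfl

/-- **`PacketGOfRecord.ext_fin` — A COHERENT HOMOGENEOUS PACKET IS DETERMINED BY ITS FINITE PART** (`Q.1.inf = infOfOfRecord … Q.1.fin` by coherence ★ `.inf_eq`; the
remaining fields are proofs): the functional content of the dealer's J3-R4 reading. [cite: Rogawski1990, §13.3 Thm. 13.3.5 p. 202] -/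
theorem PacketGOfRecord.ext_fin [Nonempty 𝔞.PktInf] {Q Q' : PacketGOfRecord 𝔩 𝔞 μ Pk} (h : Q.1.fin = Q'.1.fin) : Q = Q' := by
  have hinf : Q.1.inf = Q'.1.inf := by rw [Q.2.1, Q'.2.1, h]
  apply Subtype.ext
  obtain ⟨⟨fin, inf, hd⟩, hQ⟩ := Q
  obtain ⟨⟨fin', inf', hd'⟩, hQ'⟩ := Q'
  simp only at h hinf
  subst h
  subst hinf
  rfl

/-- **`liftsTo` IS FUNCTIONAL**: `Π(ρ)` is unique among the packets of record (`ext_fin` ∘ `globalPacket_ext`). [cite: Rogawski1990, §13.3 Thm. 13.3.5 p. 202] -/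
theorem LiftsToOfRecord.packet_eq [Nonempty 𝔞.PktInf] {ρ : PacketHOfRecord 𝔩 𝔞 𝔞H μ₂ μ₁ archH} {Q Q' : PacketGOfRecord 𝔩 𝔞 μ Pk}
    (h : LiftsToOfRecord 𝔩 𝔞 𝔞H μ μ₂ μ₁ archH Pk ρ Q) (h' : LiftsToOfRecord 𝔩 𝔞 𝔞H μ μ₂ μ₁ archH Pk ρ Q') : Q = Q' :=
  PacketGOfRecord.ext_fin (globalPacket_ext fun v => (h v).trans (h' v).symm)

/-- Unfolding of `IsAPacketOfRecord`. [cite: Rogawski1990, §13.3 p. 201 l. 16] -/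
theorem isAPacketOfRecord_iff [Nonempty 𝔞.PktInf] (Q : PacketGOfRecord 𝔩 𝔞 μ Pk) :
    IsAPacketOfRecord 𝔩 𝔞 𝔞H μ μ₂ μ₁ archH Pk Q ↔ ∃ ρ : PacketHOfRecord 𝔩 𝔞 𝔞H μ₂ μ₁ archH, IsOneDimH ρ ∧ LiftsToOfRecord 𝔩 𝔞 𝔞H μ μ₂ μ₁ archH Pk ρ Q :=
  Iff.rfl

/-- Unfolding of `IsThetaFin`. [cite: Rogawski1990, §13.3 p. 203] -/
theorem isThetaFin_iff (μω : HeckeCharacter L) (σ : GlobalPacketH 𝔩) :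
    IsThetaFin 𝔩 μ₂ μ₁ μω σ ↔
      ∃ (π₂ : ∀ v : HeightOneSpectrum (𝓞 ↥(maximalRealSubfield L)), IrrClass ((cmDatum L 2 (Φ L 2)).Local v))
        (χ₁ : ∀ v : HeightOneSpectrum (𝓞 ↥(maximalRealSubfield L)), ((cmDatum L 1 (Φ L 1)).Local v) →* ℂˣ)
        (hχ₁ : ∀ v : HeightOneSpectrum (𝓞 ↥(maximalRealSubfield L)),
          IsOpen (((χ₁ v).ker : Subgroup ((cmDatum L 1 (Φ L 1)).Local v)) : Set ((cmDatum L 1 (Φ L 1)).Local v))),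
        IsRealisedH 𝔩 μ₂ μ₁ σ π₂ χ₁ hχ₁ ∧ R90.S5.IsThetaOfRecord L μω π₂ :=
  Iff.rfl

/-- A θ-lift of record is realised (first conjunct). [cite: Rogawski1990, §13.3 p. 202] -/
theorem IsThetaFin.exists_isRealisedH {μω : HeckeCharacter L} {σ : GlobalPacketH 𝔩} (h : IsThetaFin 𝔩 μ₂ μ₁ μω σ) :
    ∃ (π₂ : ∀ v : HeightOneSpectrum (𝓞 ↥(maximalRealSubfield L)), IrrClass ((cmDatum L 2 (Φ L 2)).Local v))
      (χ₁ : ∀ v : HeightOneSpectrum (𝓞 ↥(maximalRealSubfield L)), ((cmDatum L 1 (Φ L 1)).Local v) →* ℂˣ)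
      (hχ₁ : ∀ v : HeightOneSpectrum (𝓞 ↥(maximalRealSubfield L)),
        IsOpen (((χ₁ v).ker : Subgroup ((cmDatum L 1 (Φ L 1)).Local v)) : Set ((cmDatum L 1 (Φ L 1)).Local v))),
      IsRealisedH 𝔩 μ₂ μ₁ σ π₂ χ₁ hχ₁ := by
  obtain ⟨π₂, χ₁, hχ₁, hR, -⟩ := h
  exact ⟨π₂, χ₁, hχ₁, hR⟩

/-- `nH` of record on a non-θ packet is `1` (C §1 ★ `nHOfRecord_of_not_isTheta` at `IsThetaFin`). [cite: Rogawski1990, §13.3 p. 203] -/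
theorem nHOfRecord_isThetaFin_of_not {μω : HeckeCharacter L} (ρ : PacketHOfRecord 𝔩 𝔞 𝔞H μ₂ μ₁ archH) (h : ¬ IsThetaFin 𝔩 μ₂ μ₁ μω ρ.fin) :
    nHOfRecord (IsThetaFin 𝔩 μ₂ μ₁ μω) ρ = 1 :=
  nHOfRecord_of_not_isTheta _ ρ h

/-- `nH` of record on a θ-packet is `½`. [cite: Rogawski1990, §13.3 p. 203] -/
theorem nHOfRecord_isThetaFin_of {μω : HeckeCharacter L} (ρ : PacketHOfRecord 𝔩 𝔞 𝔞H μ₂ μ₁ archH) (h : IsThetaFin 𝔩 μ₂ μ₁ μω ρ.fin) :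
    nHOfRecord (IsThetaFin 𝔩 μ₂ μ₁ μω) ρ = 1 / 2 :=
  nHOfRecord_of_isTheta _ ρ h

/-- The finite part of `packetHOfOneDim … ξ` is ★ `rhoXi h8 ξ` (`rfl`). [cite: Rogawski1990, §13.1 p. 199] -/
theorem packetHOfOneDim_fin (h8 : ∀ v : HeightOneSpectrum (𝓞 ↥(maximalRealSubfield L)), (𝔩 v).OneDimHLaw)
    (hunr : ∀ ξ : OneDimAutRepH L, ∀ᶠ v : HeightOneSpectrum (𝓞 ↥(maximalRealSubfield L)) in cofinite, (𝔩 v).unr ((𝔩 v).xiH ((GlobalPacketH.rhoXi h8 ξ).loc v)))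
    (ξ : OneDimAutRepH L) : (packetHOfOneDim 𝔩 𝔞 𝔞H μ₂ μ₁ archH h8 hunr ξ).fin = GlobalPacketH.rhoXi h8 ξ :=
  rfl

/-- The archimedean packet of `packetHOfOneDim … ξ` is `archH` of its own realising pair (`rfl`). [cite: Rogawski1990, §12.1 p. 171; §13.3 p. 202] -/
theorem packetHOfOneDim_inf (h8 : ∀ v : HeightOneSpectrum (𝓞 ↥(maximalRealSubfield L)), (𝔩 v).OneDimHLaw)
    (hunr : ∀ ξ : OneDimAutRepH L, ∀ᶠ v : HeightOneSpectrum (𝓞 ↥(maximalRealSubfield L)) in cofinite, (𝔩 v).unr ((𝔩 v).xiH ((GlobalPacketH.rhoXi h8 ξ).loc v)))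
    (ξ : OneDimAutRepH L) : (packetHOfOneDim 𝔩 𝔞 𝔞H μ₂ μ₁ archH h8 hunr ξ).inf = archH (piTwoOfOneDim ξ) (chiOneOfOneDim ξ) :=
  rfl

/-- The local `H`-packets of `packetHOfOneDim … ξ` are the singletons `{⟦ξ_v⟧}` (★ `memH_rhoXi_loc` via ★ `memH_spectralPacketHOfOneDim_fin_loc`). [cite: Rogawski1990, §12.1 p. 171; §13.1 p. 199] -/
theorem memH_packetHOfOneDim_fin_loc (h8 : ∀ v : HeightOneSpectrum (𝓞 ↥(maximalRealSubfield L)), (𝔩 v).OneDimHLaw)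
    (hunr : ∀ ξ : OneDimAutRepH L, ∀ᶠ v : HeightOneSpectrum (𝓞 ↥(maximalRealSubfield L)) in cofinite, (𝔩 v).unr ((𝔩 v).xiH ((GlobalPacketH.rhoXi h8 ξ).loc v)))
    (ξ : OneDimAutRepH L) (v : HeightOneSpectrum (𝓞 ↥(maximalRealSubfield L))) :
    (𝔩 v).memH ((packetHOfOneDim 𝔩 𝔞 𝔞H μ₂ μ₁ archH h8 hunr ξ).fin.loc v) =
      {IrrClass.mk (SmoothIrrep.ofChar (ξ.xiLocalChar v) (F0P3XiLocalCharOpenKernel.isOpen_ker_xiLocalChar L ξ v))} :=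
  GlobalPacketH.memH_rhoXi_loc h8 ξ v

/-- `packetHOfOneDim … ξ` is one-dimensional (★ `isOneDimH_spectralPacketHOfOneDim`). [cite: Rogawski1990, §13.3 p. 203] -/
theorem isOneDimH_packetHOfOneDim (h8 : ∀ v : HeightOneSpectrum (𝓞 ↥(maximalRealSubfield L)), (𝔩 v).OneDimHLaw)
    (hunr : ∀ ξ : OneDimAutRepH L, ∀ᶠ v : HeightOneSpectrum (𝓞 ↥(maximalRealSubfield L)) in cofinite, (𝔩 v).unr ((𝔩 v).xiH ((GlobalPacketH.rhoXi h8 ξ).loc v)))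
    (ξ : OneDimAutRepH L) : IsOneDimH (packetHOfOneDim 𝔩 𝔞 𝔞H μ₂ μ₁ archH h8 hunr ξ) :=
  isOneDimH_spectralPacketHOfOneDim h8 ξ _ _ _

/-- Two spectral `H`-packets with the same finite part and the same archimedean packet are equal (structure eta). [cite: Rogawski1990, §13.3 p. 202] -/
theorem spectralPacketH_ext {DiscH : GlobalPacketH 𝔩 → 𝔞H.PktInfH → Prop} {ρ ρ' : SpectralPacketH 𝔩 𝔞 𝔞H DiscH}
    (h₁ : ρ.fin = ρ'.fin) (h₂ : ρ.inf = ρ'.inf) : ρ = ρ' := by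
  obtain ⟨fin, inf, hc, hd⟩ := ρ
  obtain ⟨fin', inf', hc', hd'⟩ := ρ'
  simp only at h₁ h₂
  subst h₁
  subst h₂
  rfl

/-- **THE DEALER'S SHAPE AT THE RECORD: `IsOneDimH ρ ↔ ∃ ξ, ρ = packetHOfOneDim … ξ`** (under (ℓ8); ★ `isOneDimH_iff_exists_eq_spectralPacketHOfOneDim` + UNIQUENESS of the
archimedean slot ★ `eq_archH_of_discH_shape`). [cite: Rogawski1990, §13.3 p. 203; §12.1 p. 171] -/
theorem isOneDimH_iff_eq_packetHOfOneDim (h8 : ∀ v : HeightOneSpectrum (𝓞 ↥(maximalRealSubfield L)), (𝔩 v).OneDimHLaw)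
    (hunr : ∀ ξ : OneDimAutRepH L, ∀ᶠ v : HeightOneSpectrum (𝓞 ↥(maximalRealSubfield L)) in cofinite, (𝔩 v).unr ((𝔩 v).xiH ((GlobalPacketH.rhoXi h8 ξ).loc v)))
    (ρ : PacketHOfRecord 𝔩 𝔞 𝔞H μ₂ μ₁ archH) :
    IsOneDimH ρ ↔ ∃ ξ : OneDimAutRepH L, ρ = packetHOfOneDim 𝔩 𝔞 𝔞H μ₂ μ₁ archH h8 hunr ξ := by
  constructor
  · intro h
    obtain ⟨ξ, hunr', hdisc, hρ⟩ := (isOneDimH_iff_exists_eq_spectralPacketHOfOneDim h8 ρ).1 h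
    have hinf : ρ.inf = archH (piTwoOfOneDim ξ) (chiOneOfOneDim ξ) := eq_archH_of_discH_shape μ₂ μ₁ h8 archH ξ hdisc
    refine ⟨ξ, spectralPacketH_ext ?_ ?_⟩
    · rw [hρ]; rfl
    · rw [hinf]; rfl
  · rintro ⟨ξ, rfl⟩
    exact isOneDimH_packetHOfOneDim h8 hunr ξ

/-- **JQ-3 READ-BACK**: under (ℓ8), `IsAPacketOfRecord Q ↔ ∃ ξ, LiftsToOfRecord (packetHOfOneDim … ξ) Q` (the dealer's reading of `Π_a`). [cite: Rogawski1990, §13.3 p. 201 l. 16; Thm. 13.3.7 pp. 202–203] -/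
theorem isAPacketOfRecord_iff_exists_packetHOfOneDim [Nonempty 𝔞.PktInf] (h8 : ∀ v : HeightOneSpectrum (𝓞 ↥(maximalRealSubfield L)), (𝔩 v).OneDimHLaw)
    (hunr : ∀ ξ : OneDimAutRepH L, ∀ᶠ v : HeightOneSpectrum (𝓞 ↥(maximalRealSubfield L)) in cofinite, (𝔩 v).unr ((𝔩 v).xiH ((GlobalPacketH.rhoXi h8 ξ).loc v)))
    (Q : PacketGOfRecord 𝔩 𝔞 μ Pk) :
    IsAPacketOfRecord 𝔩 𝔞 𝔞H μ μ₂ μ₁ archH Pk Q ↔ ∃ ξ : OneDimAutRepH L, LiftsToOfRecord 𝔩 𝔞 𝔞H μ μ₂ μ₁ archH Pk (packetHOfOneDim 𝔩 𝔞 𝔞H μ₂ μ₁ archH h8 hunr ξ) Q := by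
  constructor
  · rintro ⟨ρ, h1, hl⟩
    obtain ⟨ξ, rfl⟩ := (isOneDimH_iff_eq_packetHOfOneDim h8 hunr ρ).1 h1
    exact ⟨ξ, hl⟩
  · rintro ⟨ξ, hl⟩
    exact ⟨_, isOneDimH_packetHOfOneDim h8 hunr ξ, hl⟩

/-- Under `Q = Π(ξ)`, the local packets of `Q` are the kit transfers of the singleton packets of `ξ` (for K2E3-p21's DEAL #21 input `hR`). [cite: Rogawski1990, §13.1 p. 199; Prop. 13.1.3 (d) p. 199] -/
theorem LiftsToOfRecord.loc_eq_xiH_rhoXi [Nonempty 𝔞.PktInf] (h8 : ∀ v : HeightOneSpectrum (𝓞 ↥(maximalRealSubfield L)), (𝔩 v).OneDimHLaw)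
    (hunr : ∀ ξ : OneDimAutRepH L, ∀ᶠ v : HeightOneSpectrum (𝓞 ↥(maximalRealSubfield L)) in cofinite, (𝔩 v).unr ((𝔩 v).xiH ((GlobalPacketH.rhoXi h8 ξ).loc v)))
    {ξ : OneDimAutRepH L} {Q : PacketGOfRecord 𝔩 𝔞 μ Pk} (hl : LiftsToOfRecord 𝔩 𝔞 𝔞H μ μ₂ μ₁ archH Pk (packetHOfOneDim 𝔩 𝔞 𝔞H μ₂ μ₁ archH h8 hunr ξ) Q)
    (v : HeightOneSpectrum (𝓞 ↥(maximalRealSubfield L))) : Q.1.fin.loc v = (𝔩 v).xiH ((GlobalPacketH.rhoXi h8 ξ).loc v) :=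
  hl v

/-! ## §4 Law (T′) AT THE RECORD — «a one-dimensional `ξ ∈ Π(H)` is never a θ-lift», PAID (no stub) [§13.3 p. 203; Prop. 11.4.1 (a)] -/

/-- **LAW (T′) PAID: `¬ IsThetaFin … (packetHOfOneDim … ξ).fin`** — the realising pair of `ξ`'s packet is unique (★ `eq_piTwoOfOneDim_and_eq_chiOneOfOneDim_of_boxChar_mem`), its
`U(Φ₂)`-string is `piTwoOfOneDim ξ` (one-dimensional), and ★ `not_isThetaOfRecord_piTwoOfOneDim` (R90-C14-p02 ★ p862110 ∘ R90-C133-p03's ξ-corollary: a one-dimensional class is no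
constituent of the irreducible unitary principal series at a split place).  This is the socket `stub_R90_S5_oneDim_notTheta` of the dealer's plan, CLOSED here; so `nH (packetHOfOneDim ξ) = 1`.
[cite: Rogawski1990, §13.3 p. 203; §11.4 Prop. 11.4.1 (a) p. 166; §11.1 Prop. 11.1.1 (a) p. 162] -/
theorem not_isThetaFin_packetHOfOneDim {μω : HeckeCharacter L} (hμu : μω.IsUnitary)
    (h8 : ∀ v : HeightOneSpectrum (𝓞 ↥(maximalRealSubfield L)), (𝔩 v).OneDimHLaw)
    (hunr : ∀ ξ : OneDimAutRepH L, ∀ᶠ v : HeightOneSpectrum (𝓞 ↥(maximalRealSubfield L)) in cofinite, (𝔩 v).unr ((𝔩 v).xiH ((GlobalPacketH.rhoXi h8 ξ).loc v)))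
    (ξ : OneDimAutRepH L) : ¬ IsThetaFin 𝔩 μ₂ μ₁ μω (packetHOfOneDim 𝔩 𝔞 𝔞H μ₂ μ₁ archH h8 hunr ξ).fin := by
  rintro ⟨π₂, χ₁, hχ₁, hR, hθ⟩
  obtain ⟨rfl, -⟩ := eq_piTwoOfOneDim_and_eq_chiOneOfOneDim_of_boxChar_mem h8 ξ hR.2.2
  exact not_isThetaOfRecord_piTwoOfOneDim L μω hμu ξ hθ

/-- Hence `(gOfRecord …).IsTheta (packetHOfOneDim … ξ)` FAILS and `nH` of record at `ξ` is `1` (print: `n(ξ) = 1` for one-dimensional `ξ`). [cite: Rogawski1990, §13.3 p. 203] -/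
theorem nHOfRecord_packetHOfOneDim {μω : HeckeCharacter L} (hμu : μω.IsUnitary)
    (h8 : ∀ v : HeightOneSpectrum (𝓞 ↥(maximalRealSubfield L)), (𝔩 v).OneDimHLaw)
    (hunr : ∀ ξ : OneDimAutRepH L, ∀ᶠ v : HeightOneSpectrum (𝓞 ↥(maximalRealSubfield L)) in cofinite, (𝔩 v).unr ((𝔩 v).xiH ((GlobalPacketH.rhoXi h8 ξ).loc v)))
    (ξ : OneDimAutRepH L) : nHOfRecord (IsThetaFin 𝔩 μ₂ μ₁ μω) (packetHOfOneDim 𝔩 𝔞 𝔞H μ₂ μ₁ archH h8 hunr ξ) = 1 :=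
  nHOfRecord_isThetaFin_of_not _ (not_isThetaFin_packetHOfOneDim hμu h8 hunr ξ)

/-- The 𝔨-level form S10-F reads: `IsOneDimH ρ → ¬ IsTheta ρ` at the record (★ `aPacketMult_of_coreLaws`' `hnt`). [cite: Rogawski1990, §13.3 p. 203] -/
theorem not_isThetaFin_of_isOneDimH {μω : HeckeCharacter L} (hμu : μω.IsUnitary)
    (h8 : ∀ v : HeightOneSpectrum (𝓞 ↥(maximalRealSubfield L)), (𝔩 v).OneDimHLaw)
    (hunr : ∀ ξ : OneDimAutRepH L, ∀ᶠ v : HeightOneSpectrum (𝓞 ↥(maximalRealSubfield L)) in cofinite, (𝔩 v).unr ((𝔩 v).xiH ((GlobalPacketH.rhoXi h8 ξ).loc v)))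
    {ρ : PacketHOfRecord 𝔩 𝔞 𝔞H μ₂ μ₁ archH} (h1 : IsOneDimH ρ) : ¬ IsThetaFin 𝔩 μ₂ μ₁ μω ρ.fin := by
  obtain ⟨ξ, rfl⟩ := (isOneDimH_iff_eq_packetHOfOneDim h8 hunr ρ).1 h1
  exact not_isThetaFin_packetHOfOneDim hμu h8 hunr ξ

end ReadBacks

/-! ## §5 LAW (T′) KIT-LAW-FREE (ED. 2a; S5-R5 «ROAD 0»): the F-facing head WITHOUT (ℓ8) `h8` and WITHOUT `hunr` [Thm. 13.3.6 (c) p. 202; §13.3 p. 203; §12.1 p. 171] -/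

section LawFreeOneDim

/-- **UNIQUENESS OF THE REALISING PAIR, KIT-LAW-FREE** (generic kit family `𝔩`): if `σ_v = {⟦ξ_v⟧}` at every `v` (★ `GlobalPacketH.IsCharPacket`) and `π₂,v ⊠ χ₁,v ∈ σ_v` at
every `v`, then `π₂ = piTwoOfOneDim ξ` and `χ₁ = chiOneOfOneDim ξ` (★ `IrrClass.boxChar_eq_boxChar_iff`: `⊠` is injective on classes AND characters).  Same proof as ★
`eq_piTwoOfOneDim_and_eq_chiOneOfOneDim_of_boxChar_mem`, with `hσ v` in place of ★ `memH_rhoXi_loc h8 ξ v` — so NO (ℓ8) pin. [cite: Rogawski1990, §12.1 p. 171; §13.1 p. 199] [cite: BushnellHenniart2006, §9.1] -/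
theorem eq_piTwoOfOneDim_and_eq_chiOneOfOneDim_of_isCharPacket {H' : Matrix (Fin 3) (Fin 3) L}
    {𝔩 : ∀ v : HeightOneSpectrum (𝓞 ↥(maximalRealSubfield L)), LocalPacketKit L H' v} (ξ : OneDimAutRepH L) {σ : GlobalPacketH 𝔩}
    (hσ : σ.IsCharPacket (fun v => ξ.xiLocalChar v) (fun v => F0P3XiLocalCharOpenKernel.isOpen_ker_xiLocalChar L ξ v))
    {π₂ : ∀ v : HeightOneSpectrum (𝓞 ↥(maximalRealSubfield L)), IrrClass ((cmDatum L 2 (Matrix.of fun i j : Fin 2 => if i.val + j.val + 1 = 2 then (1 : L) else 0)).Local v)}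
    {χ₁ : ∀ v : HeightOneSpectrum (𝓞 ↥(maximalRealSubfield L)), ((cmDatum L 1 (Matrix.of fun i j : Fin 1 => if i.val + j.val + 1 = 1 then (1 : L) else 0)).Local v) →* ℂˣ}
    {hχ₁ : ∀ v : HeightOneSpectrum (𝓞 ↥(maximalRealSubfield L)),
      IsOpen (((χ₁ v).ker : Subgroup ((cmDatum L 1 (Matrix.of fun i j : Fin 1 => if i.val + j.val + 1 = 1 then (1 : L) else 0)).Local v)) :
        Set ((cmDatum L 1 (Matrix.of fun i j : Fin 1 => if i.val + j.val + 1 = 1 then (1 : L) else 0)).Local v))}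
    (hmem : ∀ v : HeightOneSpectrum (𝓞 ↥(maximalRealSubfield L)), IrrClass.boxChar (χ₁ v) (hχ₁ v) (π₂ v) ∈ (𝔩 v).memH (σ.loc v)) :
    π₂ = piTwoOfOneDim ξ ∧ χ₁ = chiOneOfOneDim ξ := by
  have key : ∀ v : HeightOneSpectrum (𝓞 ↥(maximalRealSubfield L)), π₂ v = piTwoOfOneDim ξ v ∧ χ₁ v = chiOneOfOneDim ξ v := fun v => by
    have h := hmem v
    rw [hσ v, Finset.mem_singleton, ← boxChar_chiOneOfOneDim_piTwoOfOneDim ξ v] at h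
    exact (IrrClass.boxChar_eq_boxChar_iff (hχ₁ v) (isOpen_ker_chiOneOfOneDim ξ v)).1 h
  exact ⟨funext fun v => (key v).1, funext fun v => (key v).2⟩

variable {𝔩 : ∀ v : HeightOneSpectrum (𝓞 ↥(maximalRealSubfield L)), LocalPacketKit L (splitForm L 3) v} {𝔞 : ArchPacketKit} {𝔞H : ArchPacketKitH 𝔞}
  {μ₂ : Measure (adelicGroupData (↥(maximalRealSubfield L)) L (IsCMField.complexConj L) 2 (Φ L 2)).automorphicQuotient}
  [(adelicGroupData (↥(maximalRealSubfield L)) L (IsCMField.complexConj L) 2 (Φ L 2)).IsAutomorphicMeasure μ₂]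
  {μ₁ : Measure (adelicGroupData (↥(maximalRealSubfield L)) L (IsCMField.complexConj L) 1 (Φ L 1)).automorphicQuotient}
  [(adelicGroupData (↥(maximalRealSubfield L)) L (IsCMField.complexConj L) 1 (Φ L 1)).IsAutomorphicMeasure μ₁]
  {archH : (∀ v : HeightOneSpectrum (𝓞 ↥(maximalRealSubfield L)), IrrClass ((cmDatum L 2 (Φ L 2)).Local v)) →
    (∀ v : HeightOneSpectrum (𝓞 ↥(maximalRealSubfield L)), ((cmDatum L 1 (Φ L 1)).Local v) →* ℂˣ) → 𝔞H.PktInfH}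

/-- **(T′) ON ANY CHARACTER-PACKET FAMILY, (ℓ8)-FREE**: if `σ_v = {⟦ξ_v⟧}` everywhere, then `σ` is not (realised by) a θ-lift `ρ(θ)` of record — its realising pair is forced
to be `(piTwoOfOneDim ξ, chiOneOfOneDim ξ)` (above) and ★ `not_isThetaOfRecord_piTwoOfOneDim` applies (a one-dimensional class is no constituent of the irreducible unitary
principal series at a split place; `μω` unitary). [cite: Rogawski1990, Thm. 13.3.6 (c) p. 202; §13.3 p. 203; §11.4 Prop. 11.4.1 (a) p. 166; §11.1 Prop. 11.1.1 (a) p. 162] -/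
theorem not_isThetaFin_of_isCharPacket {μω : HeckeCharacter L} (hμu : μω.IsUnitary) (ξ : OneDimAutRepH L) {σ : GlobalPacketH 𝔩}
    (hσ : σ.IsCharPacket (fun v => ξ.xiLocalChar v) (fun v => F0P3XiLocalCharOpenKernel.isOpen_ker_xiLocalChar L ξ v)) :
    ¬ IsThetaFin 𝔩 μ₂ μ₁ μω σ := by
  rintro ⟨π₂, χ₁, hχ₁, hR, hθ⟩
  obtain ⟨rfl, -⟩ := eq_piTwoOfOneDim_and_eq_chiOneOfOneDim_of_isCharPacket ξ hσ hR.2.2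
  exact not_isThetaOfRecord_piTwoOfOneDim L μω hμu ξ hθ

/-- **THE F-FACING HEAD, (ℓ8)-FREE AND `hunr`-FREE: `IsOneDimH ρ → ¬ IsThetaFin … ρ.fin`** (S10-F's binder `h1` ∕ ★ `aPacketMult_of_coreLaws`' `hnt`) — §4's
`not_isThetaFin_of_isOneDimH hμu h8 hunr h1` WITHOUT the (ℓ8) pin (refuted at the record kit) and WITHOUT the unramifiedness datum; binder-for-binder the same otherwise, so
consumers re-point by dropping two arguments. [cite: Rogawski1990, Thm. 13.3.6 (c) p. 202; §13.3 p. 203; §11.4 Prop. 11.4.1 (a) p. 166] -/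
theorem not_isThetaFin_of_isOneDimH₀ {μω : HeckeCharacter L} (hμu : μω.IsUnitary)
    {ρ : PacketHOfRecord 𝔩 𝔞 𝔞H μ₂ μ₁ archH} (h1 : IsOneDimH ρ) : ¬ IsThetaFin 𝔩 μ₂ μ₁ μω ρ.fin := by
  obtain ⟨ξ, hξ⟩ := h1
  exact not_isThetaFin_of_isCharPacket hμu ξ hξ

/-- OLD → NEW (`example`): §4's (ℓ8)-bound head is the special case of `not_isThetaFin_of_isOneDimH₀` — the binders `h8`, `hunr` are idle (underscored). [cite: Rogawski1990, §13.3 p. 203] -/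
example {μω : HeckeCharacter L} (hμu : μω.IsUnitary)
    (_h8 : ∀ v : HeightOneSpectrum (𝓞 ↥(maximalRealSubfield L)), (𝔩 v).OneDimHLaw)
    (_hunr : ∀ ξ : OneDimAutRepH L, ∀ᶠ v : HeightOneSpectrum (𝓞 ↥(maximalRealSubfield L)) in cofinite, (𝔩 v).unr ((𝔩 v).xiH ((GlobalPacketH.rhoXi _h8 ξ).loc v)))
    {ρ : PacketHOfRecord 𝔩 𝔞 𝔞H μ₂ μ₁ archH} (h1 : IsOneDimH ρ) : ¬ IsThetaFin 𝔩 μ₂ μ₁ μω ρ.fin :=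
  not_isThetaFin_of_isOneDimH₀ hμu h1

/-- NEW → OLD agrees (`example`): on `packetHOfOneDim … h8 hunr ξ` the new head gives §4's `not_isThetaFin_packetHOfOneDim` verbatim. [cite: Rogawski1990, §13.3 p. 203] -/
example {μω : HeckeCharacter L} (hμu : μω.IsUnitary)
    (h8 : ∀ v : HeightOneSpectrum (𝓞 ↥(maximalRealSubfield L)), (𝔩 v).OneDimHLaw)
    (hunr : ∀ ξ : OneDimAutRepH L, ∀ᶠ v : HeightOneSpectrum (𝓞 ↥(maximalRealSubfield L)) in cofinite, (𝔩 v).unr ((𝔩 v).xiH ((GlobalPacketH.rhoXi h8 ξ).loc v)))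
    (ξ : OneDimAutRepH L) : ¬ IsThetaFin 𝔩 μ₂ μ₁ μω (packetHOfOneDim 𝔩 𝔞 𝔞H μ₂ μ₁ archH h8 hunr ξ).fin :=
  not_isThetaFin_of_isOneDimH₀ hμu (isOneDimH_packetHOfOneDim h8 hunr ξ)

end LawFreeOneDim

/-! ## §6 THE ONE-DIMENSIONAL PACKET OF RECORD AND ITS READ-BACKS UNDER THE SATISFIABLE KIT LAW (ℓ8ᵁ) `OneDimHLawU` (ED. 2b; S5-R5 (iii) «ROAD U»; HEADS-C2.ed2 §2): the
EXISTENCE side of §1 ∕ §3 ∕ §4 re-pointed from (ℓ8) `h8` (refuted at the record kit) to (ℓ8ᵁ) `h8U` — U-twins, token for token, of `packetHOfOneDim` and its eight read-backs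
[§13.3 pp. 202–203; §12.1 p. 171 type (3); §13.1 p. 199] -/

section OneDimUDef

variable (𝔩 : ∀ v : HeightOneSpectrum (𝓞 ↥(maximalRealSubfield L)), LocalPacketKit L (splitForm L 3) v) (𝔞 : ArchPacketKit) (𝔞H : ArchPacketKitH 𝔞)
  (μ₂ : Measure (adelicGroupData (↥(maximalRealSubfield L)) L (IsCMField.complexConj L) 2 (Φ L 2)).automorphicQuotient)
  [(adelicGroupData (↥(maximalRealSubfield L)) L (IsCMField.complexConj L) 2 (Φ L 2)).IsAutomorphicMeasure μ₂]
  (μ₁ : Measure (adelicGroupData (↥(maximalRealSubfield L)) L (IsCMField.complexConj L) 1 (Φ L 1)).automorphicQuotient)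
  [(adelicGroupData (↥(maximalRealSubfield L)) L (IsCMField.complexConj L) 1 (Φ L 1)).IsAutomorphicMeasure μ₁]
  (archH : (∀ v : HeightOneSpectrum (𝓞 ↥(maximalRealSubfield L)), IrrClass ((cmDatum L 2 (Φ L 2)).Local v)) →
    (∀ v : HeightOneSpectrum (𝓞 ↥(maximalRealSubfield L)), ((cmDatum L 1 (Φ L 1)).Local v) →* ℂˣ) → 𝔞H.PktInfH)

/-- **`packetHOfOneDimU … h8U hunrU ξ` — THE ONE-DIMENSIONAL `ξ ∈ Π(H)` AS A DISCRETE `H`-PACKET OF RECORD, UNDER (ℓ8ᵁ)** — the U-twin of §1 `packetHOfOneDim`, SAME SHAPE for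
consumers (`𝔩 𝔞 𝔞H μ₂ μ₁ archH` explicit, then the law, the unramifiedness datum, `ξ`): finite part ★ `GlobalPacketH.rhoXiU h8U ξ` (★ W1 `R90S4OneDimHLawU`, p863008: the
singleton packets `{⟦ξ_v⟧}` pinned by the SATISFIABLE law (ℓ8ᵁ) «a UNITARIZABLE one-dimensional representation of `H_v` is an L-packet of cardinality one», the unitarizability of
`⟦ξ_v⟧` discharged INSIDE `rhoXiU` by ★ `isUnitarizable_mk_ofChar_xiLocalChar` p862777 — invisible to consumers), archimedean packet `archH` OF ITS OWN REALISING PAIR, discreteness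
of record ★ `discH_shape_rhoXiU` (★ W3 `R90S5SpectralPacketHOfOneDimU`, p863058).  (ℓ8) `h8 : ∀ v, (𝔩 v).OneDimHLaw` is REFUTED at the record kit for every CM `L` (S5-audit1 (g2)
scratch c23d2e3a4e794d19, split-place witness `𝟙 ⊠ |det|_v`); (ℓ8ᵁ) holds there (JQ-S5→S4-2, S4's (R-a)).  §1's `packetHOfOneDim` stays as typed (sound over an abstract `𝔩`).
[cite: Rogawski1990, §13.3 pp. 202–203; §12.1 p. 171; §13.1 p. 199] -/
noncomputable def packetHOfOneDimU (h8U : ∀ v : HeightOneSpectrum (𝓞 ↥(maximalRealSubfield L)), (𝔩 v).OneDimHLawU)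
    (hunrU : ∀ ξ : OneDimAutRepH L, ∀ᶠ v : HeightOneSpectrum (𝓞 ↥(maximalRealSubfield L)) in cofinite,
      (𝔩 v).unr ((𝔩 v).xiH ((GlobalPacketH.rhoXiU h8U ξ).loc v)))
    (ξ : OneDimAutRepH L) : PacketHOfRecord 𝔩 𝔞 𝔞H μ₂ μ₁ archH :=
  spectralPacketHOfOneDimU h8U ξ (archH (piTwoOfOneDim ξ) (chiOneOfOneDim ξ)) (hunrU ξ) (discH_shape_rhoXiU μ₂ μ₁ h8U archH ξ)

end OneDimUDef

section OneDimReadBacksU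

variable {𝔩 : ∀ v : HeightOneSpectrum (𝓞 ↥(maximalRealSubfield L)), LocalPacketKit L (splitForm L 3) v} {𝔞 : ArchPacketKit} {𝔞H : ArchPacketKitH 𝔞}
  {μ : Measure (adelicGroupData (↥(maximalRealSubfield L)) L (IsCMField.complexConj L) 3 (splitForm L 3)).automorphicQuotient}
  [(adelicGroupData (↥(maximalRealSubfield L)) L (IsCMField.complexConj L) 3 (splitForm L 3)).IsAutomorphicMeasure μ]
  {μ₂ : Measure (adelicGroupData (↥(maximalRealSubfield L)) L (IsCMField.complexConj L) 2 (Φ L 2)).automorphicQuotient}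
  [(adelicGroupData (↥(maximalRealSubfield L)) L (IsCMField.complexConj L) 2 (Φ L 2)).IsAutomorphicMeasure μ₂]
  {μ₁ : Measure (adelicGroupData (↥(maximalRealSubfield L)) L (IsCMField.complexConj L) 1 (Φ L 1)).automorphicQuotient}
  [(adelicGroupData (↥(maximalRealSubfield L)) L (IsCMField.complexConj L) 1 (Φ L 1)).IsAutomorphicMeasure μ₁]
  {archH : (∀ v : HeightOneSpectrum (𝓞 ↥(maximalRealSubfield L)), IrrClass ((cmDatum L 2 (Φ L 2)).Local v)) →
    (∀ v : HeightOneSpectrum (𝓞 ↥(maximalRealSubfield L)), ((cmDatum L 1 (Φ L 1)).Local v) →* ℂˣ) → 𝔞H.PktInfH}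
  {Pk : OneDimAutRepH L → ∀ v : HeightOneSpectrum (𝓞 ↥(maximalRealSubfield L)), CMLocalAPacket L (splitForm L 3) v}

/-- The finite part of `packetHOfOneDimU … ξ` is ★ `rhoXiU h8U ξ` (`rfl`). [cite: Rogawski1990, §13.1 p. 199] -/
theorem packetHOfOneDimU_fin (h8U : ∀ v : HeightOneSpectrum (𝓞 ↥(maximalRealSubfield L)), (𝔩 v).OneDimHLawU)
    (hunrU : ∀ ξ : OneDimAutRepH L, ∀ᶠ v : HeightOneSpectrum (𝓞 ↥(maximalRealSubfield L)) in cofinite, (𝔩 v).unr ((𝔩 v).xiH ((GlobalPacketH.rhoXiU h8U ξ).loc v)))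
    (ξ : OneDimAutRepH L) : (packetHOfOneDimU 𝔩 𝔞 𝔞H μ₂ μ₁ archH h8U hunrU ξ).fin = GlobalPacketH.rhoXiU h8U ξ :=
  rfl

/-- The archimedean packet of `packetHOfOneDimU … ξ` is `archH` of its own realising pair (`rfl`). [cite: Rogawski1990, §12.1 p. 171; §13.3 p. 202] -/
theorem packetHOfOneDimU_inf (h8U : ∀ v : HeightOneSpectrum (𝓞 ↥(maximalRealSubfield L)), (𝔩 v).OneDimHLawU)
    (hunrU : ∀ ξ : OneDimAutRepH L, ∀ᶠ v : HeightOneSpectrum (𝓞 ↥(maximalRealSubfield L)) in cofinite, (𝔩 v).unr ((𝔩 v).xiH ((GlobalPacketH.rhoXiU h8U ξ).loc v)))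
    (ξ : OneDimAutRepH L) : (packetHOfOneDimU 𝔩 𝔞 𝔞H μ₂ μ₁ archH h8U hunrU ξ).inf = archH (piTwoOfOneDim ξ) (chiOneOfOneDim ξ) :=
  rfl

/-- The local `H`-packets of `packetHOfOneDimU … ξ` are the singletons `{⟦ξ_v⟧}` (★ `memH_rhoXiU_loc`, W1). [cite: Rogawski1990, §12.1 p. 171; §13.1 p. 199] -/
theorem memH_packetHOfOneDimU_fin_loc (h8U : ∀ v : HeightOneSpectrum (𝓞 ↥(maximalRealSubfield L)), (𝔩 v).OneDimHLawU)
    (hunrU : ∀ ξ : OneDimAutRepH L, ∀ᶠ v : HeightOneSpectrum (𝓞 ↥(maximalRealSubfield L)) in cofinite, (𝔩 v).unr ((𝔩 v).xiH ((GlobalPacketH.rhoXiU h8U ξ).loc v)))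
    (ξ : OneDimAutRepH L) (v : HeightOneSpectrum (𝓞 ↥(maximalRealSubfield L))) :
    (𝔩 v).memH ((packetHOfOneDimU 𝔩 𝔞 𝔞H μ₂ μ₁ archH h8U hunrU ξ).fin.loc v) =
      {IrrClass.mk (SmoothIrrep.ofChar (ξ.xiLocalChar v) (F0P3XiLocalCharOpenKernel.isOpen_ker_xiLocalChar L ξ v))} :=
  GlobalPacketH.memH_rhoXiU_loc h8U ξ v

/-- `packetHOfOneDimU … ξ` is one-dimensional (★ `isOneDimH_spectralPacketHOfOneDimU`, W3). [cite: Rogawski1990, §13.3 p. 203] -/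
theorem isOneDimH_packetHOfOneDimU (h8U : ∀ v : HeightOneSpectrum (𝓞 ↥(maximalRealSubfield L)), (𝔩 v).OneDimHLawU)
    (hunrU : ∀ ξ : OneDimAutRepH L, ∀ᶠ v : HeightOneSpectrum (𝓞 ↥(maximalRealSubfield L)) in cofinite, (𝔩 v).unr ((𝔩 v).xiH ((GlobalPacketH.rhoXiU h8U ξ).loc v)))
    (ξ : OneDimAutRepH L) : IsOneDimH (packetHOfOneDimU 𝔩 𝔞 𝔞H μ₂ μ₁ archH h8U hunrU ξ) :=
  isOneDimH_spectralPacketHOfOneDimU h8U ξ _ _ _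

/-- **THE DEALER'S SHAPE AT THE RECORD, UNDER (ℓ8ᵁ): `IsOneDimH ρ ↔ ∃ ξ, ρ = packetHOfOneDimU … ξ`** (★ `isOneDimH_iff_exists_eq_spectralPacketHOfOneDimU` + UNIQUENESS of the
archimedean slot ★ `eq_archH_of_discH_shapeU`, W3; §3 `spectralPacketH_ext`). [cite: Rogawski1990, §13.3 p. 203; §12.1 p. 171] -/
theorem isOneDimH_iff_eq_packetHOfOneDimU (h8U : ∀ v : HeightOneSpectrum (𝓞 ↥(maximalRealSubfield L)), (𝔩 v).OneDimHLawU)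
    (hunrU : ∀ ξ : OneDimAutRepH L, ∀ᶠ v : HeightOneSpectrum (𝓞 ↥(maximalRealSubfield L)) in cofinite, (𝔩 v).unr ((𝔩 v).xiH ((GlobalPacketH.rhoXiU h8U ξ).loc v)))
    (ρ : PacketHOfRecord 𝔩 𝔞 𝔞H μ₂ μ₁ archH) :
    IsOneDimH ρ ↔ ∃ ξ : OneDimAutRepH L, ρ = packetHOfOneDimU 𝔩 𝔞 𝔞H μ₂ μ₁ archH h8U hunrU ξ := by
  constructor
  · intro h
    obtain ⟨ξ, hunr', hdisc, hρ⟩ := (isOneDimH_iff_exists_eq_spectralPacketHOfOneDimU h8U ρ).1 h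
    have hinf : ρ.inf = archH (piTwoOfOneDim ξ) (chiOneOfOneDim ξ) := eq_archH_of_discH_shapeU μ₂ μ₁ h8U archH ξ hdisc
    refine ⟨ξ, spectralPacketH_ext ?_ ?_⟩
    · rw [hρ]; rfl
    · rw [hinf]; rfl
  · rintro ⟨ξ, rfl⟩
    exact isOneDimH_packetHOfOneDimU h8U hunrU ξ

/-- **JQ-3 READ-BACK UNDER (ℓ8ᵁ)**: `IsAPacketOfRecord Q ↔ ∃ ξ, LiftsToOfRecord (packetHOfOneDimU … ξ) Q` (the dealer's reading of `Π_a`; `IsAPacketOfRecord` itself is kit-law-free, F1).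
[cite: Rogawski1990, §13.3 p. 201 l. 16; Thm. 13.3.7 pp. 202–203] -/
theorem isAPacketOfRecord_iff_exists_packetHOfOneDimU [Nonempty 𝔞.PktInf] (h8U : ∀ v : HeightOneSpectrum (𝓞 ↥(maximalRealSubfield L)), (𝔩 v).OneDimHLawU)
    (hunrU : ∀ ξ : OneDimAutRepH L, ∀ᶠ v : HeightOneSpectrum (𝓞 ↥(maximalRealSubfield L)) in cofinite, (𝔩 v).unr ((𝔩 v).xiH ((GlobalPacketH.rhoXiU h8U ξ).loc v)))
    (Q : PacketGOfRecord 𝔩 𝔞 μ Pk) :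
    IsAPacketOfRecord 𝔩 𝔞 𝔞H μ μ₂ μ₁ archH Pk Q ↔ ∃ ξ : OneDimAutRepH L, LiftsToOfRecord 𝔩 𝔞 𝔞H μ μ₂ μ₁ archH Pk (packetHOfOneDimU 𝔩 𝔞 𝔞H μ₂ μ₁ archH h8U hunrU ξ) Q := by
  constructor
  · rintro ⟨ρ, h1, hl⟩
    obtain ⟨ξ, rfl⟩ := (isOneDimH_iff_eq_packetHOfOneDimU h8U hunrU ρ).1 h1
    exact ⟨ξ, hl⟩
  · rintro ⟨ξ, hl⟩
    exact ⟨_, isOneDimH_packetHOfOneDimU h8U hunrU ξ, hl⟩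

/-- Under `Q = Π(ξ)` (U-law), the local packets of `Q` are the kit transfers of the singleton packets of `ξ`. [cite: Rogawski1990, §13.1 p. 199; Prop. 13.1.3 (d) p. 199] -/
theorem LiftsToOfRecord.loc_eq_xiH_rhoXiU [Nonempty 𝔞.PktInf] (h8U : ∀ v : HeightOneSpectrum (𝓞 ↥(maximalRealSubfield L)), (𝔩 v).OneDimHLawU)
    (hunrU : ∀ ξ : OneDimAutRepH L, ∀ᶠ v : HeightOneSpectrum (𝓞 ↥(maximalRealSubfield L)) in cofinite, (𝔩 v).unr ((𝔩 v).xiH ((GlobalPacketH.rhoXiU h8U ξ).loc v)))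
    {ξ : OneDimAutRepH L} {Q : PacketGOfRecord 𝔩 𝔞 μ Pk} (hl : LiftsToOfRecord 𝔩 𝔞 𝔞H μ μ₂ μ₁ archH Pk (packetHOfOneDimU 𝔩 𝔞 𝔞H μ₂ μ₁ archH h8U hunrU ξ) Q)
    (v : HeightOneSpectrum (𝓞 ↥(maximalRealSubfield L))) : Q.1.fin.loc v = (𝔩 v).xiH ((GlobalPacketH.rhoXiU h8U ξ).loc v) :=
  hl v

/-- **LAW (T′) at `packetHOfOneDimU ξ`, PAID via §5 (ROAD 0)**: `¬ IsThetaFin … (packetHOfOneDimU … ξ).fin` — the (ℓ8)-free head `not_isThetaFin_of_isOneDimH₀` applied to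
`isOneDimH_packetHOfOneDimU`. [cite: Rogawski1990, §13.3 p. 203; §11.4 Prop. 11.4.1 (a) p. 166; §11.1 Prop. 11.1.1 (a) p. 162] -/
theorem not_isThetaFin_packetHOfOneDimU {μω : HeckeCharacter L} (hμu : μω.IsUnitary)
    (h8U : ∀ v : HeightOneSpectrum (𝓞 ↥(maximalRealSubfield L)), (𝔩 v).OneDimHLawU)
    (hunrU : ∀ ξ : OneDimAutRepH L, ∀ᶠ v : HeightOneSpectrum (𝓞 ↥(maximalRealSubfield L)) in cofinite, (𝔩 v).unr ((𝔩 v).xiH ((GlobalPacketH.rhoXiU h8U ξ).loc v)))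
    (ξ : OneDimAutRepH L) : ¬ IsThetaFin 𝔩 μ₂ μ₁ μω (packetHOfOneDimU 𝔩 𝔞 𝔞H μ₂ μ₁ archH h8U hunrU ξ).fin :=
  not_isThetaFin_of_isOneDimH₀ hμu (isOneDimH_packetHOfOneDimU h8U hunrU ξ)

/-- Hence `nH` of record at `packetHOfOneDimU ξ` is `1` (print: `n(ξ) = 1` for one-dimensional `ξ`). [cite: Rogawski1990, §13.3 p. 203] -/
theorem nHOfRecord_packetHOfOneDimU {μω : HeckeCharacter L} (hμu : μω.IsUnitary)
    (h8U : ∀ v : HeightOneSpectrum (𝓞 ↥(maximalRealSubfield L)), (𝔩 v).OneDimHLawU)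
    (hunrU : ∀ ξ : OneDimAutRepH L, ∀ᶠ v : HeightOneSpectrum (𝓞 ↥(maximalRealSubfield L)) in cofinite, (𝔩 v).unr ((𝔩 v).xiH ((GlobalPacketH.rhoXiU h8U ξ).loc v)))
    (ξ : OneDimAutRepH L) : nHOfRecord (IsThetaFin 𝔩 μ₂ μ₁ μω) (packetHOfOneDimU 𝔩 𝔞 𝔞H μ₂ μ₁ archH h8U hunrU ξ) = 1 :=
  nHOfRecord_isThetaFin_of_not _ (not_isThetaFin_packetHOfOneDimU hμu h8U hunrU ξ)

/-- **OLD → NEW MONOTONICITY (R-QS1-7)**: under the strong law (ℓ8) `h8`, with `h8U := fun v => (h8 v).toU` (★ `OneDimHLaw.toU`, W1), the U-constructor IS §1's constructor: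
`packetHOfOneDimU … (fun v => (h8 v).toU) hunrU ξ = packetHOfOneDim … h8 hunr ξ` (finite parts by ★ `rhoXiU_toU_eq_rhoXi`, archimedean slots `rfl`, §3 `spectralPacketH_ext`).
[cite: Rogawski1990, §12.1 p. 171; §13.3 p. 202] -/
theorem packetHOfOneDimU_toU_eq_packetHOfOneDim (h8 : ∀ v : HeightOneSpectrum (𝓞 ↥(maximalRealSubfield L)), (𝔩 v).OneDimHLaw)
    (hunr : ∀ ξ : OneDimAutRepH L, ∀ᶠ v : HeightOneSpectrum (𝓞 ↥(maximalRealSubfield L)) in cofinite, (𝔩 v).unr ((𝔩 v).xiH ((GlobalPacketH.rhoXi h8 ξ).loc v)))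
    (hunrU : ∀ ξ : OneDimAutRepH L, ∀ᶠ v : HeightOneSpectrum (𝓞 ↥(maximalRealSubfield L)) in cofinite,
      (𝔩 v).unr ((𝔩 v).xiH ((GlobalPacketH.rhoXiU (fun v => (h8 v).toU) ξ).loc v)))
    (ξ : OneDimAutRepH L) :
    packetHOfOneDimU 𝔩 𝔞 𝔞H μ₂ μ₁ archH (fun v => (h8 v).toU) hunrU ξ = packetHOfOneDim 𝔩 𝔞 𝔞H μ₂ μ₁ archH h8 hunr ξ :=
  spectralPacketH_ext (by rw [packetHOfOneDimU_fin, packetHOfOneDim_fin]; exact GlobalPacketH.rhoXiU_toU_eq_rhoXi h8 ξ) rfl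

/-- OLD → NEW (`example`): the unramifiedness datum transports along ★ `rhoXiU_toU_eq_rhoXi`, so §1's binders `(h8, hunr)` FEED the U-constructor. [cite: Rogawski1990, §13.1 p. 199] -/
example (h8 : ∀ v : HeightOneSpectrum (𝓞 ↥(maximalRealSubfield L)), (𝔩 v).OneDimHLaw)
    (hunr : ∀ ξ : OneDimAutRepH L, ∀ᶠ v : HeightOneSpectrum (𝓞 ↥(maximalRealSubfield L)) in cofinite, (𝔩 v).unr ((𝔩 v).xiH ((GlobalPacketH.rhoXi h8 ξ).loc v)))
    (ξ : OneDimAutRepH L) :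
    ∀ᶠ v : HeightOneSpectrum (𝓞 ↥(maximalRealSubfield L)) in cofinite, (𝔩 v).unr ((𝔩 v).xiH ((GlobalPacketH.rhoXiU (fun v => (h8 v).toU) ξ).loc v)) := by
  rw [GlobalPacketH.rhoXiU_toU_eq_rhoXi]
  exact hunr ξ

/-- NEW → OLD agrees (`example`): on the U-constructor the §5 head and `not_isThetaFin_packetHOfOneDimU` coincide (proof irrelevance; shape check for S10-F ED. 2 ∕ S5-D ED. 4′).
[cite: Rogawski1990, §13.3 p. 203] -/
example {μω : HeckeCharacter L} (hμu : μω.IsUnitary)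
    (h8U : ∀ v : HeightOneSpectrum (𝓞 ↥(maximalRealSubfield L)), (𝔩 v).OneDimHLawU)
    (hunrU : ∀ ξ : OneDimAutRepH L, ∀ᶠ v : HeightOneSpectrum (𝓞 ↥(maximalRealSubfield L)) in cofinite, (𝔩 v).unr ((𝔩 v).xiH ((GlobalPacketH.rhoXiU h8U ξ).loc v)))
    (ξ : OneDimAutRepH L) : ¬ IsThetaFin 𝔩 μ₂ μ₁ μω (packetHOfOneDimU 𝔩 𝔞 𝔞H μ₂ μ₁ archH h8U hunrU ξ).fin :=
  not_isThetaFin_of_isOneDimH₀ hμu (isOneDimH_packetHOfOneDimU h8U hunrU ξ)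

end OneDimReadBacksU

/-! ## §7 (ED. 2c) S9 PAYERS IN C2's OWN CURRENCY — preimage uniqueness on `Π_a` («`Π̂(ξ) = {ξ} ∪ {1}`», `Card(Π̂) = 2`, p. 203; Thm. 13.3.4), `n = ½` on `Π_a` (Thm. 13.3.7), and the
A-packet `Π(ξ)` of record `aPacketOfRecordU` (p. 199 ¶2; p. 201 l. 16) with `IsAPacket Π(ξ) ∧ liftsTo ξ Π(ξ)` — HYPOTHESES-FIRST over ★ `R90S5XiHFibreOneDimU` (ℓ-ξfib) and ★ `R90S5APacketGOfOneDimU`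
((A-TOK), (A-OCC)); nothing posited, no socket closed [§13.3 pp. 201–203; §13.1 pp. 198–199] -/

section S9Payers

variable {𝔩 : ∀ v : HeightOneSpectrum (𝓞 ↥(maximalRealSubfield L)), LocalPacketKit L (splitForm L 3) v} {𝔞 : ArchPacketKit} {𝔞H : ArchPacketKitH 𝔞}
  {μ : Measure (adelicGroupData (↥(maximalRealSubfield L)) L (IsCMField.complexConj L) 3 (splitForm L 3)).automorphicQuotient}
  [(adelicGroupData (↥(maximalRealSubfield L)) L (IsCMField.complexConj L) 3 (splitForm L 3)).IsAutomorphicMeasure μ]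
  {μ₂ : Measure (adelicGroupData (↥(maximalRealSubfield L)) L (IsCMField.complexConj L) 2 (Φ L 2)).automorphicQuotient}
  [(adelicGroupData (↥(maximalRealSubfield L)) L (IsCMField.complexConj L) 2 (Φ L 2)).IsAutomorphicMeasure μ₂]
  {μ₁ : Measure (adelicGroupData (↥(maximalRealSubfield L)) L (IsCMField.complexConj L) 1 (Φ L 1)).automorphicQuotient}
  [(adelicGroupData (↥(maximalRealSubfield L)) L (IsCMField.complexConj L) 1 (Φ L 1)).IsAutomorphicMeasure μ₁]
  {archH : (∀ v : HeightOneSpectrum (𝓞 ↥(maximalRealSubfield L)), IrrClass ((cmDatum L 2 (Φ L 2)).Local v)) →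
    (∀ v : HeightOneSpectrum (𝓞 ↥(maximalRealSubfield L)), ((cmDatum L 1 (Φ L 1)).Local v) →* ℂˣ) → 𝔞H.PktInfH}
  [Nonempty 𝔞.PktInf] {Pk : OneDimAutRepH L → ∀ v : HeightOneSpectrum (𝓞 ↥(maximalRealSubfield L)), CMLocalAPacket L (splitForm L 3) v}
  (μω : HeckeCharacter L)
  (pairG : Option (PacketHOfRecord 𝔩 𝔞 𝔞H μ₂ μ₁ archH) →
    DiscreteClass (adelicGroupData (↥(maximalRealSubfield L)) L (IsCMField.complexConj L) 3 (splitForm L 3)) μ → ℂ)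

/-- **V1 · PREIMAGE UNIQUENESS ON `Π_a` — S9-B's `sock_S9_lifts1_cm` «`IsAPacket P → liftsTo ρ P → liftsTo ρ′ P → ρ = ρ′`» IN C2's CURRENCY, MODULO (ℓ-ξfib)**: if `Q ∈ Π_a(G)` (`IsAPacketOfRecord`:
`Q = Π(ρ₀)` with `ρ₀ ∈ Π(H)` one-dimensional) and `Q = Π(ρ) = Π(ρ′)` (`LiftsToOfRecord`) for two DISCRETE `H`-packets of record `ρ, ρ′`, then `ρ = ρ′` — print: «`Π̂ = {ρ ∈ Π(H) : Π = Π(ρ)} ∪ {1}`»,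
«`Π̂(ξ) = {ξ} ∪ {1}`», `Card(Π̂) = 2` for `Π ∈ Π_a` (p. 203; Thm. 13.3.4; Prop. 13.1.2 (c): `ξ_H⁻¹(Π(ξ_v)) = {ξ_v}`).  PROOF = ★ p863407 `eq_of_isOneDimH_of_liftsTo_shape` (R90-C133-p01) AT THE
RECORD: `DiscH := discHOfRecord 𝔩 𝔞H μ₂ μ₁ archH` HAS the required shape `DiscH σ P → ∃ π₂ χ₁ hχ₁, IsRealisedH … ∧ P = archH π₂ χ₁` by `fun _ _ h => h` (delta of C :112), `Qloc := Q.1.fin.loc`.  The kit law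
(ℓ-ξfib) `hfib : ∀ v, (𝔩 v).XiHFibreLawOneDim` («the `ξ_H`-fibre through a one-dimensional `H_v`-packet is a singleton», ★ `LocalPacketKit.XiHFibreLawOneDim`) is a HYPOTHESIS here — S4's law row at
`rogawskiLocalKit` (JQ-S5→S4-8), paid or refuted there, never posited by S5. [cite: Rogawski1990, §13.3 p. 203, Thm. 13.3.4 p. 202, Thm. 13.3.7 pp. 202–203; §13.1 Prop. 13.1.2 (c) p. 198; §12.2 p. 174] -/
theorem liftsToOfRecord_oneDim_unique (hfib : ∀ v : HeightOneSpectrum (𝓞 ↥(maximalRealSubfield L)), (𝔩 v).XiHFibreLawOneDim)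
    {Q : PacketGOfRecord 𝔩 𝔞 μ Pk} (hQ : IsAPacketOfRecord 𝔩 𝔞 𝔞H μ μ₂ μ₁ archH Pk Q) (ρ ρ' : PacketHOfRecord 𝔩 𝔞 𝔞H μ₂ μ₁ archH)
    (hρ : LiftsToOfRecord 𝔩 𝔞 𝔞H μ μ₂ μ₁ archH Pk ρ Q) (hρ' : LiftsToOfRecord 𝔩 𝔞 𝔞H μ μ₂ μ₁ archH Pk ρ' Q) : ρ = ρ' := by
  obtain ⟨ρ₀, h₀, hl₀⟩ := hQ
  exact eq_of_isOneDimH_of_liftsTo_shape μ₂ μ₁ archH hfib (fun _ _ h => h) h₀ hl₀ ρ ρ' hρ hρ'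

/-- **V1′ · `gOfRecord`-LEVEL READER = `sock_S9_lifts1_cm` VERBATIM**: `(gOfRecord …).IsAPacket Q → (gOfRecord …).liftsTo ρ Q → (gOfRecord …).liftsTo ρ′ Q → ρ = ρ′` (V1 through the `rfl` read-backs §2.1
`gOfRecord_IsAPacket` ∕ `gOfRecord_liftsTo`; binders in `𝔊`-currency `(gOfRecord …).Packet` ∕ `.PacketH`), MODULO (ℓ-ξfib). [cite: Rogawski1990, §13.3 p. 203, Thm. 13.3.4 p. 202; §13.1 Prop. 13.1.2 (c) p. 198] -/
theorem gOfRecord_liftsTo_unique_of_isAPacket (hfib : ∀ v : HeightOneSpectrum (𝓞 ↥(maximalRealSubfield L)), (𝔩 v).XiHFibreLawOneDim)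
    {Q : (gOfRecord 𝔩 𝔞 𝔞H μ μ₂ μ₁ archH Pk μω pairG).Packet} (hQ : (gOfRecord 𝔩 𝔞 𝔞H μ μ₂ μ₁ archH Pk μω pairG).IsAPacket Q) (ρ ρ' : (gOfRecord 𝔩 𝔞 𝔞H μ μ₂ μ₁ archH Pk μω pairG).PacketH)
    (hρ : (gOfRecord 𝔩 𝔞 𝔞H μ μ₂ μ₁ archH Pk μω pairG).liftsTo ρ Q) (hρ' : (gOfRecord 𝔩 𝔞 𝔞H μ μ₂ μ₁ archH Pk μω pairG).liftsTo ρ' Q) : ρ = ρ' :=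
  liftsToOfRecord_oneDim_unique hfib hQ ρ ρ' hρ hρ'

/-- **V2 · THE DISCRETE `H`-PREIMAGE OF `Π(ξ)`'s PACKET IS `ξ`'s PACKET OF RECORD** (modulo (ℓ8ᵁ) + (ℓ-ξfib)): if `Q = Π(packetHOfOneDimU … ξ)` and `Q = Π(ρ′)` for a discrete `H`-packet of record `ρ′`,
then `ρ′ = packetHOfOneDimU 𝔩 𝔞 𝔞H μ₂ μ₁ archH h8U hunrU ξ` («`Π̂(ξ) = {ξ} ∪ {1}`», p. 203) — ★ p863407 `eq_spectralPacketHOfOneDimU_of_forall_xiH_eq` read with `hl v := (hρ′ v)⁻¹ ⬝ (§6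
`LiftsToOfRecord.loc_eq_xiH_rhoXiU … hl₀ v)`, `hshape := ρ′.isDiscrete` (delta of `discHOfRecord`), `hunr := hunrU ξ`, `hdisc := discH_shape_rhoXiU …`; the right-hand side is U1's body (§6 :580).
(Equivalently V1 at `hQ := ⟨_, isOneDimH_packetHOfOneDimU h8U hunrU ξ, hl₀⟩` — the `example` below.) [cite: Rogawski1990, §13.3 p. 203, Thm. 13.3.4 p. 202; §13.1 Prop. 13.1.2 (c) p. 198, p. 199 ¶2] -/
theorem eq_packetHOfOneDimU_of_liftsToOfRecord (hfib : ∀ v : HeightOneSpectrum (𝓞 ↥(maximalRealSubfield L)), (𝔩 v).XiHFibreLawOneDim)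
    (h8U : ∀ v : HeightOneSpectrum (𝓞 ↥(maximalRealSubfield L)), (𝔩 v).OneDimHLawU)
    (hunrU : ∀ ξ : OneDimAutRepH L, ∀ᶠ v : HeightOneSpectrum (𝓞 ↥(maximalRealSubfield L)) in cofinite, (𝔩 v).unr ((𝔩 v).xiH ((GlobalPacketH.rhoXiU h8U ξ).loc v)))
    (ξ : OneDimAutRepH L) {Q : PacketGOfRecord 𝔩 𝔞 μ Pk} (hl₀ : LiftsToOfRecord 𝔩 𝔞 𝔞H μ μ₂ μ₁ archH Pk (packetHOfOneDimU 𝔩 𝔞 𝔞H μ₂ μ₁ archH h8U hunrU ξ) Q)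
    (ρ' : PacketHOfRecord 𝔩 𝔞 𝔞H μ₂ μ₁ archH) (hρ' : LiftsToOfRecord 𝔩 𝔞 𝔞H μ μ₂ μ₁ archH Pk ρ' Q) :
    ρ' = packetHOfOneDimU 𝔩 𝔞 𝔞H μ₂ μ₁ archH h8U hunrU ξ :=
  eq_spectralPacketHOfOneDimU_of_forall_xiH_eq μ₂ μ₁ archH h8U hfib ξ ρ' (fun v => (hρ' v).symm.trans (LiftsToOfRecord.loc_eq_xiH_rhoXiU h8U hunrU hl₀ v))
    ρ'.isDiscrete (hunrU ξ) (discH_shape_rhoXiU μ₂ μ₁ h8U archH ξ)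

example (hfib : ∀ v : HeightOneSpectrum (𝓞 ↥(maximalRealSubfield L)), (𝔩 v).XiHFibreLawOneDim) (h8U : ∀ v : HeightOneSpectrum (𝓞 ↥(maximalRealSubfield L)), (𝔩 v).OneDimHLawU)
    (hunrU : ∀ ξ : OneDimAutRepH L, ∀ᶠ v : HeightOneSpectrum (𝓞 ↥(maximalRealSubfield L)) in cofinite, (𝔩 v).unr ((𝔩 v).xiH ((GlobalPacketH.rhoXiU h8U ξ).loc v)))
    (ξ : OneDimAutRepH L) {Q : PacketGOfRecord 𝔩 𝔞 μ Pk} (hl₀ : LiftsToOfRecord 𝔩 𝔞 𝔞H μ μ₂ μ₁ archH Pk (packetHOfOneDimU 𝔩 𝔞 𝔞H μ₂ μ₁ archH h8U hunrU ξ) Q)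
    (ρ' : PacketHOfRecord 𝔩 𝔞 𝔞H μ₂ μ₁ archH) (hρ' : LiftsToOfRecord 𝔩 𝔞 𝔞H μ μ₂ μ₁ archH Pk ρ' Q) : ρ' = packetHOfOneDimU 𝔩 𝔞 𝔞H μ₂ μ₁ archH h8U hunrU ξ :=
  liftsToOfRecord_oneDim_unique hfib ⟨_, isOneDimH_packetHOfOneDimU h8U hunrU ξ, hl₀⟩ ρ' _ hρ' hl₀

/-- **X1 · ROW `hlifts1` VERBATIM — `(gOfRecord …).lifts Q = {ρ}` ON `Π_a`, MODULO (ℓ-ξfib)**: ★ `GlobalPacketData.lifts 𝔊 Q = {ρ ∣ 𝔊.liftsTo ρ Q}` (= print's `Π̂(Q) ∖ {1}`) is the singleton of ANY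
lift `ρ` of an A-packet `Q` of record (`⊆` is V1, `⊇` is `hρ`); S9-B's `hlifts1 : IsAPacket P → IsOneDimH ξ → liftsTo ξ P → X.G.lifts P = {ξ}` is this row with its (unused) `IsOneDimH ξ` binder dropped.
[cite: Rogawski1990, §13.3 p. 203 «`Π̂ = {ρ ∈ Π(H) : Π = Π(ρ)} ∪ {1}`, `Π̂(ξ) = {ξ} ∪ {1}`», Thm. 13.3.7 pp. 202–203] -/
theorem gOfRecord_lifts_eq_singleton (hfib : ∀ v : HeightOneSpectrum (𝓞 ↥(maximalRealSubfield L)), (𝔩 v).XiHFibreLawOneDim)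
    {Q : (gOfRecord 𝔩 𝔞 𝔞H μ μ₂ μ₁ archH Pk μω pairG).Packet} (hQ : (gOfRecord 𝔩 𝔞 𝔞H μ μ₂ μ₁ archH Pk μω pairG).IsAPacket Q) (ρ : (gOfRecord 𝔩 𝔞 𝔞H μ μ₂ μ₁ archH Pk μω pairG).PacketH)
    (hρ : (gOfRecord 𝔩 𝔞 𝔞H μ μ₂ μ₁ archH Pk μω pairG).liftsTo ρ Q) : (gOfRecord 𝔩 𝔞 𝔞H μ μ₂ μ₁ archH Pk μω pairG).lifts Q = {ρ} :=
  Set.eq_singleton_iff_unique_mem.2 ⟨hρ, fun ρ' h => liftsToOfRecord_oneDim_unique hfib hQ ρ' ρ h hρ⟩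

/-- **X1′ · `Card(Π̂(Q)) = 2` ON `Π_a`** (★ `GlobalPacketData.cardHat Q = (lifts Q).ncard + 1`, X1, `Set.ncard_singleton`) — print: «`n(Π) = Card(Π̂)⁻¹`», `Card(Π̂(ξ)) = 2` (Thm. 13.3.7, p. 203), MODULO (ℓ-ξfib).
[cite: Rogawski1990, §13.3 Thm. 13.3.7 pp. 202–203, p. 203] -/
theorem gOfRecord_cardHat_eq_two (hfib : ∀ v : HeightOneSpectrum (𝓞 ↥(maximalRealSubfield L)), (𝔩 v).XiHFibreLawOneDim)
    {Q : (gOfRecord 𝔩 𝔞 𝔞H μ μ₂ μ₁ archH Pk μω pairG).Packet} (hQ : (gOfRecord 𝔩 𝔞 𝔞H μ μ₂ μ₁ archH Pk μω pairG).IsAPacket Q) (ρ : (gOfRecord 𝔩 𝔞 𝔞H μ μ₂ μ₁ archH Pk μω pairG).PacketH)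
    (hρ : (gOfRecord 𝔩 𝔞 𝔞H μ μ₂ μ₁ archH Pk μω pairG).liftsTo ρ Q) : (gOfRecord 𝔩 𝔞 𝔞H μ μ₂ μ₁ archH Pk μω pairG).cardHat Q = 2 := by
  rw [GlobalPacketData.cardHat_def, gOfRecord_lifts_eq_singleton μω pairG hfib hQ ρ hρ, Set.ncard_singleton]

/-- **X2 · ROW `hn` IN C2's CURRENCY — `nGOfRecord … Q = ½` ON `Π_a`, MODULO (ℓ-ξfib)**: C ED. 4's `nGOfRecord 𝔩 𝔞 μ μ₂ μ₁ Pk Q = Q.1.n ‹realisability›` (C :302; `nGOfRecord_eq`, `rfl`) equals `½` whenever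
`Q = Π(ρ₀)` with `ρ₀ ∈ Π(H)` one-dimensional and discrete of record — ★ p863407 `n_eq_half_of_isOneDimH_of_liftsTo_shape` with `DiscH₁ :=` C's realisability predicate `fun σ => ∃ π₂ χ₁ hχ₁, IsRealisedH …`
and `hd := discH_realised ρ₀` (C :172: a discrete `H`-packet of record IS realised); print: `n(Π) = Card(Π̂)⁻¹ = ½` for `Π ∈ Π_a` (Thm. 13.3.7, p. 203 «the fibers of `ξ_H` have cardinality `1`»).
S9-B's `hn : IsAPacket P → … → X.G.n P = 1/2` is the reader X2′ below. [cite: Rogawski1990, §13.3 Thm. 13.3.7 pp. 202–203, p. 203; §13.1 Prop. 13.1.2 (c) p. 198] -/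
theorem nGOfRecord_eq_half_of_isAPacketOfRecord (hfib : ∀ v : HeightOneSpectrum (𝓞 ↥(maximalRealSubfield L)), (𝔩 v).XiHFibreLawOneDim)
    {Q : PacketGOfRecord 𝔩 𝔞 μ Pk} (hQ : IsAPacketOfRecord 𝔩 𝔞 𝔞H μ μ₂ μ₁ archH Pk Q) : nGOfRecord 𝔩 𝔞 μ μ₂ μ₁ Pk Q = 1 / 2 := by
  obtain ⟨ρ₀, h₀, hl₀⟩ := hQ
  rw [nGOfRecord_eq]
  exact n_eq_half_of_isOneDimH_of_liftsTo_shape hfib Q.1 (fun σ => ∃ π₂ χ₁ hχ₁, IsRealisedH 𝔩 μ₂ μ₁ σ π₂ χ₁ hχ₁) h₀ (discH_realised ρ₀) hl₀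

/-- **X2′ · reader: `(gOfRecord …).n Q = ½` for `(gOfRecord …).IsAPacket Q`** — S9-B's row `hn` verbatim (its `IsOneDimH ξ` ∕ `liftsTo ξ P` binders are folded into `IsAPacket`), by X2 and the `rfl`
read-backs §2.1 `gOfRecord_IsAPacket` ∕ `gOfRecord_n`; MODULO (ℓ-ξfib). [cite: Rogawski1990, §13.3 Thm. 13.3.7 pp. 202–203] -/
theorem gOfRecord_n_eq_half_of_isAPacket (hfib : ∀ v : HeightOneSpectrum (𝓞 ↥(maximalRealSubfield L)), (𝔩 v).XiHFibreLawOneDim)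
    {Q : (gOfRecord 𝔩 𝔞 𝔞H μ μ₂ μ₁ archH Pk μω pairG).Packet} (hQ : (gOfRecord 𝔩 𝔞 𝔞H μ μ₂ μ₁ archH Pk μω pairG).IsAPacket Q) : (gOfRecord 𝔩 𝔞 𝔞H μ μ₂ μ₁ archH Pk μω pairG).n Q = 1 / 2 :=
  nGOfRecord_eq_half_of_isAPacketOfRecord hfib hQ

/-! ### §7.2 The A-packet `Π(ξ)` of record — ★ `aPacketGOfOneDimU` at `infOf := infOfOfRecord 𝔩 𝔞 μ`, `aTok := aTokOfRecord 𝔩 Pk` [§13.1 p. 199 ¶2; §13.3 p. 201 l. 16, Thm. 13.3.5, Thm. 13.3.6 (b)] -/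

variable (𝔩 𝔞 μ Pk) in
/-- **V3 · `aPacketOfRecordU 𝔩 𝔞 μ Pk h8U hunrU ξ hAtok hdisc : PacketGOfRecord 𝔩 𝔞 μ Pk` — THE A-PACKET `Π(ξ) = ⊗_v Π(ξ_v)` OF THE ONE-DIMENSIONAL `ξ ∈ Π(H)` AS A PACKET OF RECORD** («`Π(ξ) = {πⁿ(ξ), πˢ(ξ)}`
… we call a packet of this type an A-packet», p. 199 ¶2; `Π_a(G) = {Π(ξ) : dim ξ = 1}`, p. 201 l. 16): ★ `aPacketGOfOneDimU h8U hunrU ξ infOf aTok hAtok hdisc` (R90-C133-p01, «S9-READERS (R-b)») AT THE RECORD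
`infOf := infOfOfRecord 𝔩 𝔞 μ` (C :141), `aTok := aTokOfRecord 𝔩 Pk` (C :152) — finite family `v ↦ ξ_H((rhoXiU h8U ξ)_v)` (`Π(ξ_v) = ξ_H({ξ_v})`, §13.1 (13.1.3)), archimedean component `infOfOfRecord` OF ITS OWN
finite part (coherence by `rfl`), all-A by (A-TOK), discrete by (A-OCC).  HYPOTHESES-FIRST, SAME SHAPE AS U1 (`𝔩 𝔞 μ Pk` explicit; then (ℓ8ᵁ) `h8U`, the unramifiedness datum `hunrU` — U1 :580 verbatim —, `ξ`,
then the two NAMED DEBT ROWS of the ★ brick, neither posited here): (A-TOK) `hAtok : ∀ v, ξ_H((rhoXiU h8U ξ)_v) ∈ aTokOfRecord 𝔩 Pk v` («`ξ_H({ξ_v})` is an A-token of the family `Pk`» — S4∕S7's law row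
at `rogawskiLocalKit`, JQ-S5→S4-9); (A-OCC) `hdisc : (Π(rhoXiU h8U ξ)).IsDiscrete μ` («some member of `Π(ξ)` occurs in `L²_disc(G, μ)`» = Thm. 13.3.6 (b) `m(⊗_v πⁿ(ξ_v)) = 1`, the 13.3.7 chain of
S5-D ∕ S10-F).  No (ℓ8)-twin is typed (cf. §6). [cite: Rogawski1990, §13.1 p. 199 ¶2, Prop. 13.1.3 p. 199; §13.2 p. 200 ll. 1–3; §13.3 p. 201 ll. 10–18, Thm. 13.3.2 p. 201, Thm. 13.3.5 p. 202, Thm. 13.3.6 (b) p. 202] -/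
noncomputable def aPacketOfRecordU (h8U : ∀ v : HeightOneSpectrum (𝓞 ↥(maximalRealSubfield L)), (𝔩 v).OneDimHLawU)
    (hunrU : ∀ ξ : OneDimAutRepH L, ∀ᶠ v : HeightOneSpectrum (𝓞 ↥(maximalRealSubfield L)) in cofinite,
      (𝔩 v).unr ((𝔩 v).xiH ((GlobalPacketH.rhoXiU h8U ξ).loc v)))
    (ξ : OneDimAutRepH L)
    (hAtok : ∀ v : HeightOneSpectrum (𝓞 ↥(maximalRealSubfield L)), (𝔩 v).xiH ((GlobalPacketH.rhoXiU h8U ξ).loc v) ∈ aTokOfRecord 𝔩 Pk v)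
    (hdisc : ((GlobalPacketH.rhoXiU h8U ξ).imageG (hunrU ξ)).IsDiscrete μ) : PacketGOfRecord 𝔩 𝔞 μ Pk :=
  aPacketGOfOneDimU h8U hunrU ξ (infOfOfRecord 𝔩 𝔞 μ) (aTokOfRecord 𝔩 Pk) hAtok hdisc

/-- `aPacketOfRecordU 𝔩 𝔞 μ Pk h8U hunrU ξ hAtok hdisc = aPacketGOfOneDimU h8U hunrU ξ (infOfOfRecord 𝔩 𝔞 μ) (aTokOfRecord 𝔩 Pk) hAtok hdisc` — the ★ brick at the record (`rfl`).
[cite: Rogawski1990, §13.3 p. 201 l. 16] -/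
theorem aPacketOfRecordU_eq (h8U : ∀ v : HeightOneSpectrum (𝓞 ↥(maximalRealSubfield L)), (𝔩 v).OneDimHLawU)
    (hunrU : ∀ ξ : OneDimAutRepH L, ∀ᶠ v : HeightOneSpectrum (𝓞 ↥(maximalRealSubfield L)) in cofinite, (𝔩 v).unr ((𝔩 v).xiH ((GlobalPacketH.rhoXiU h8U ξ).loc v)))
    (ξ : OneDimAutRepH L) (hAtok : ∀ v : HeightOneSpectrum (𝓞 ↥(maximalRealSubfield L)), (𝔩 v).xiH ((GlobalPacketH.rhoXiU h8U ξ).loc v) ∈ aTokOfRecord 𝔩 Pk v)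
    (hdisc : ((GlobalPacketH.rhoXiU h8U ξ).imageG (hunrU ξ)).IsDiscrete μ) :
    aPacketOfRecordU 𝔩 𝔞 μ Pk h8U hunrU ξ hAtok hdisc = aPacketGOfOneDimU h8U hunrU ξ (infOfOfRecord 𝔩 𝔞 μ) (aTokOfRecord 𝔩 Pk) hAtok hdisc := rfl

/-- READ-BACK (`rfl`): `Π(ξ)_v = ξ_H((rhoXiU h8U ξ)_v) = Π(ξ_v)` placewise (★ `aPacketGOfOneDimU_fin_loc`). [cite: Rogawski1990, §13.1 p. 199 ¶2 (13.1.3); §13.3 p. 201 l. 12] -/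
theorem aPacketOfRecordU_fin_loc (h8U : ∀ v : HeightOneSpectrum (𝓞 ↥(maximalRealSubfield L)), (𝔩 v).OneDimHLawU)
    (hunrU : ∀ ξ : OneDimAutRepH L, ∀ᶠ v : HeightOneSpectrum (𝓞 ↥(maximalRealSubfield L)) in cofinite, (𝔩 v).unr ((𝔩 v).xiH ((GlobalPacketH.rhoXiU h8U ξ).loc v)))
    (ξ : OneDimAutRepH L) (hAtok : ∀ v : HeightOneSpectrum (𝓞 ↥(maximalRealSubfield L)), (𝔩 v).xiH ((GlobalPacketH.rhoXiU h8U ξ).loc v) ∈ aTokOfRecord 𝔩 Pk v)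
    (hdisc : ((GlobalPacketH.rhoXiU h8U ξ).imageG (hunrU ξ)).IsDiscrete μ) (v : HeightOneSpectrum (𝓞 ↥(maximalRealSubfield L))) :
    (aPacketOfRecordU 𝔩 𝔞 μ Pk h8U hunrU ξ hAtok hdisc).1.fin.loc v = (𝔩 v).xiH ((GlobalPacketH.rhoXiU h8U ξ).loc v) := rfl

/-- **V4 · `Π(ξ) = Π(packetHOfOneDimU … ξ)`**: `LiftsToOfRecord … (packetHOfOneDimU … ξ) (aPacketOfRecordU … ξ hAtok hdisc)`, placewise `rfl` (§6 U2 `packetHOfOneDimU_fin` ∕ ★ `spectralPacketHOfOneDimU_fin`; ★ p01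
`liftsTo_shape_aPacketGOfOneDimU` at the record) — print: `Π(ξ) = ⊗_v Π(ξ_v)` IS the image of `ξ` under `Π(H) → Π(G)` (p. 201 ll. 16–18). [cite: Rogawski1990, §13.3 p. 201 ll. 16–18; §13.1 p. 199 ¶2] -/
theorem liftsToOfRecord_packetHOfOneDimU_aPacketOfRecordU (h8U : ∀ v : HeightOneSpectrum (𝓞 ↥(maximalRealSubfield L)), (𝔩 v).OneDimHLawU)
    (hunrU : ∀ ξ : OneDimAutRepH L, ∀ᶠ v : HeightOneSpectrum (𝓞 ↥(maximalRealSubfield L)) in cofinite, (𝔩 v).unr ((𝔩 v).xiH ((GlobalPacketH.rhoXiU h8U ξ).loc v)))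
    (ξ : OneDimAutRepH L) (hAtok : ∀ v : HeightOneSpectrum (𝓞 ↥(maximalRealSubfield L)), (𝔩 v).xiH ((GlobalPacketH.rhoXiU h8U ξ).loc v) ∈ aTokOfRecord 𝔩 Pk v)
    (hdisc : ((GlobalPacketH.rhoXiU h8U ξ).imageG (hunrU ξ)).IsDiscrete μ) :
    LiftsToOfRecord 𝔩 𝔞 𝔞H μ μ₂ μ₁ archH Pk (packetHOfOneDimU 𝔩 𝔞 𝔞H μ₂ μ₁ archH h8U hunrU ξ) (aPacketOfRecordU 𝔩 𝔞 μ Pk h8U hunrU ξ hAtok hdisc) :=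
  fun _ => rfl

/-- **V5 · `Π(ξ) ∈ Π_a(G)` OF RECORD**: `IsAPacketOfRecord … (aPacketOfRecordU … ξ hAtok hdisc)` — witness `packetHOfOneDimU … ξ` (one-dimensional by §6 U3 `isOneDimH_packetHOfOneDimU`, lifting by V4); print:
`Π_a(G) = {Π(ξ) : ξ ∈ Π(H), dim ξ = 1}` (p. 201 l. 16). [cite: Rogawski1990, §13.3 p. 201 l. 16; §13.1 p. 199 ¶2] -/
theorem isAPacketOfRecord_aPacketOfRecordU (h8U : ∀ v : HeightOneSpectrum (𝓞 ↥(maximalRealSubfield L)), (𝔩 v).OneDimHLawU)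
    (hunrU : ∀ ξ : OneDimAutRepH L, ∀ᶠ v : HeightOneSpectrum (𝓞 ↥(maximalRealSubfield L)) in cofinite, (𝔩 v).unr ((𝔩 v).xiH ((GlobalPacketH.rhoXiU h8U ξ).loc v)))
    (ξ : OneDimAutRepH L) (hAtok : ∀ v : HeightOneSpectrum (𝓞 ↥(maximalRealSubfield L)), (𝔩 v).xiH ((GlobalPacketH.rhoXiU h8U ξ).loc v) ∈ aTokOfRecord 𝔩 Pk v)
    (hdisc : ((GlobalPacketH.rhoXiU h8U ξ).imageG (hunrU ξ)).IsDiscrete μ) :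
    IsAPacketOfRecord 𝔩 𝔞 𝔞H μ μ₂ μ₁ archH Pk (aPacketOfRecordU 𝔩 𝔞 μ Pk h8U hunrU ξ hAtok hdisc) :=
  ⟨_, isOneDimH_packetHOfOneDimU h8U hunrU ξ, liftsToOfRecord_packetHOfOneDimU_aPacketOfRecordU h8U hunrU ξ hAtok hdisc⟩

/-- **V6 · `Π(ξ)` IS THE ONLY PACKET OF RECORD TO WHICH `ξ`'s PACKET LIFTS** (★ p01 `eq_aPacketGOfOneDimU_of_liftsTo_shape`, via §6 `LiftsToOfRecord.loc_eq_xiH_rhoXiU`): a packet of record is determined by its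
finite local family (`infOf`-coherence + proof irrelevance) — print: «`Π` is an A-packet iff `dim(ρ) = 1` [for `Π = Π(ρ)`]» (Thm. 13.3.5), `Π(ρ) := ⊗ Π(ρ_v)` (p. 201 l. 12). [cite: Rogawski1990, §13.3 p. 201 ll. 12–18, Thm. 13.3.5 p. 202] -/
theorem eq_aPacketOfRecordU_of_liftsToOfRecord (h8U : ∀ v : HeightOneSpectrum (𝓞 ↥(maximalRealSubfield L)), (𝔩 v).OneDimHLawU)
    (hunrU : ∀ ξ : OneDimAutRepH L, ∀ᶠ v : HeightOneSpectrum (𝓞 ↥(maximalRealSubfield L)) in cofinite, (𝔩 v).unr ((𝔩 v).xiH ((GlobalPacketH.rhoXiU h8U ξ).loc v)))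
    (ξ : OneDimAutRepH L) (hAtok : ∀ v : HeightOneSpectrum (𝓞 ↥(maximalRealSubfield L)), (𝔩 v).xiH ((GlobalPacketH.rhoXiU h8U ξ).loc v) ∈ aTokOfRecord 𝔩 Pk v)
    (hdisc : ((GlobalPacketH.rhoXiU h8U ξ).imageG (hunrU ξ)).IsDiscrete μ) (Q : PacketGOfRecord 𝔩 𝔞 μ Pk)
    (hQ : LiftsToOfRecord 𝔩 𝔞 𝔞H μ μ₂ μ₁ archH Pk (packetHOfOneDimU 𝔩 𝔞 𝔞H μ₂ μ₁ archH h8U hunrU ξ) Q) : Q = aPacketOfRecordU 𝔩 𝔞 μ Pk h8U hunrU ξ hAtok hdisc :=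
  eq_aPacketGOfOneDimU_of_liftsTo_shape h8U hunrU ξ (infOfOfRecord 𝔩 𝔞 μ) (aTokOfRecord 𝔩 Pk) hAtok hdisc Q (LiftsToOfRecord.loc_eq_xiH_rhoXiU h8U hunrU hQ)

/-- **V7 · `gOfRecord`-LEVEL READER: `(gOfRecord …).IsAPacket (aPacketOfRecordU …)`** (V5 through §2.1 `gOfRecord_IsAPacket`, `rfl`) — the `IsAPacket Pξ` conjunct of S9-B's `sock_S9_xiReaders_cm`.
[cite: Rogawski1990, §13.3 p. 201 l. 16] -/
theorem gOfRecord_IsAPacket_aPacketOfRecordU (h8U : ∀ v : HeightOneSpectrum (𝓞 ↥(maximalRealSubfield L)), (𝔩 v).OneDimHLawU)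
    (hunrU : ∀ ξ : OneDimAutRepH L, ∀ᶠ v : HeightOneSpectrum (𝓞 ↥(maximalRealSubfield L)) in cofinite, (𝔩 v).unr ((𝔩 v).xiH ((GlobalPacketH.rhoXiU h8U ξ).loc v)))
    (ξ : OneDimAutRepH L) (hAtok : ∀ v : HeightOneSpectrum (𝓞 ↥(maximalRealSubfield L)), (𝔩 v).xiH ((GlobalPacketH.rhoXiU h8U ξ).loc v) ∈ aTokOfRecord 𝔩 Pk v)
    (hdisc : ((GlobalPacketH.rhoXiU h8U ξ).imageG (hunrU ξ)).IsDiscrete μ) :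
    (gOfRecord 𝔩 𝔞 𝔞H μ μ₂ μ₁ archH Pk μω pairG).IsAPacket (aPacketOfRecordU 𝔩 𝔞 μ Pk h8U hunrU ξ hAtok hdisc) :=
  isAPacketOfRecord_aPacketOfRecordU h8U hunrU ξ hAtok hdisc

/-- **V7′ · `gOfRecord`-LEVEL READER: `(gOfRecord …).liftsTo (packetHOfOneDimU … ξ) (aPacketOfRecordU …)`** (V4 through §2.1 `gOfRecord_liftsTo`, `rfl`) — the `liftsTo ρ Pξ` conjunct of `sock_S9_xiReaders_cm`.
[cite: Rogawski1990, §13.3 p. 201 ll. 16–18] -/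
theorem gOfRecord_liftsTo_packetHOfOneDimU_aPacketOfRecordU (h8U : ∀ v : HeightOneSpectrum (𝓞 ↥(maximalRealSubfield L)), (𝔩 v).OneDimHLawU)
    (hunrU : ∀ ξ : OneDimAutRepH L, ∀ᶠ v : HeightOneSpectrum (𝓞 ↥(maximalRealSubfield L)) in cofinite, (𝔩 v).unr ((𝔩 v).xiH ((GlobalPacketH.rhoXiU h8U ξ).loc v)))
    (ξ : OneDimAutRepH L) (hAtok : ∀ v : HeightOneSpectrum (𝓞 ↥(maximalRealSubfield L)), (𝔩 v).xiH ((GlobalPacketH.rhoXiU h8U ξ).loc v) ∈ aTokOfRecord 𝔩 Pk v)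
    (hdisc : ((GlobalPacketH.rhoXiU h8U ξ).imageG (hunrU ξ)).IsDiscrete μ) :
    (gOfRecord 𝔩 𝔞 𝔞H μ μ₂ μ₁ archH Pk μω pairG).liftsTo (packetHOfOneDimU 𝔩 𝔞 𝔞H μ₂ μ₁ archH h8U hunrU ξ) (aPacketOfRecordU 𝔩 𝔞 μ Pk h8U hunrU ξ hAtok hdisc) :=
  liftsToOfRecord_packetHOfOneDimU_aPacketOfRecordU h8U hunrU ξ hAtok hdisc

/-- **V7″ · THE MIDDLE CONJUNCT OF `sock_S9_xiReaders_cm` AT `ρ := packetHOfOneDimU … ξ`**: `∃ Pξ, (gOfRecord …).IsAPacket Pξ ∧ (gOfRecord …).liftsTo (packetHOfOneDimU … ξ) Pξ`, MODULO (ℓ8ᵁ) + (A-TOK) + (A-OCC)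
(witness V3; conjuncts V7, V7′). [cite: Rogawski1990, §13.3 p. 201 ll. 16–18; §13.1 p. 199 ¶2] -/
theorem gOfRecord_exists_isAPacket_and_liftsTo_packetHOfOneDimU (h8U : ∀ v : HeightOneSpectrum (𝓞 ↥(maximalRealSubfield L)), (𝔩 v).OneDimHLawU)
    (hunrU : ∀ ξ : OneDimAutRepH L, ∀ᶠ v : HeightOneSpectrum (𝓞 ↥(maximalRealSubfield L)) in cofinite, (𝔩 v).unr ((𝔩 v).xiH ((GlobalPacketH.rhoXiU h8U ξ).loc v)))
    (ξ : OneDimAutRepH L) (hAtok : ∀ v : HeightOneSpectrum (𝓞 ↥(maximalRealSubfield L)), (𝔩 v).xiH ((GlobalPacketH.rhoXiU h8U ξ).loc v) ∈ aTokOfRecord 𝔩 Pk v)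
    (hdisc : ((GlobalPacketH.rhoXiU h8U ξ).imageG (hunrU ξ)).IsDiscrete μ) :
    ∃ Pξ, (gOfRecord 𝔩 𝔞 𝔞H μ μ₂ μ₁ archH Pk μω pairG).IsAPacket Pξ ∧
      (gOfRecord 𝔩 𝔞 𝔞H μ μ₂ μ₁ archH Pk μω pairG).liftsTo (packetHOfOneDimU 𝔩 𝔞 𝔞H μ₂ μ₁ archH h8U hunrU ξ) Pξ :=
  ⟨_, gOfRecord_IsAPacket_aPacketOfRecordU μω pairG h8U hunrU ξ hAtok hdisc, gOfRecord_liftsTo_packetHOfOneDimU_aPacketOfRecordU μω pairG h8U hunrU ξ hAtok hdisc⟩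

/-- **V8 · `n(Π(ξ)) = ½` OF RECORD**: `nGOfRecord 𝔩 𝔞 μ μ₂ μ₁ Pk (aPacketOfRecordU … ξ hAtok hdisc) = 1∕2`, MODULO (ℓ8ᵁ) + (ℓ-ξfib) + (A-TOK) + (A-OCC) — ★ p863612 `aPacketGOfOneDimU_n_eq_half` with `DiscH₁ :=`
C's realisability predicate (`nGOfRecord_eq`, `rfl`) and `hd := ⟨piTwoOfOneDim ξ, chiOneOfOneDim ξ, isOpen_ker_chiOneOfOneDim ξ, isRealisedH_shape_rhoXiU μ₂ μ₁ h8U ξ⟩` («(ℓ8ᵁ): `rhoXiU h8U ξ` is realised by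
`(π₂(ξ), χ₁(ξ))`», ★ W3); no `𝔞H` ∕ `archH` in the statement (`n` of record does not see the `H`-side archimedean kit) — for any auxiliary `𝔞H, archH` it is also X2 at V5.  Print: `n(Π(ξ)) = Card(Π̂(ξ))⁻¹ = ½`
(Thm. 13.3.7, p. 203). [cite: Rogawski1990, §13.3 Thm. 13.3.7 pp. 202–203, p. 203] -/
theorem nGOfRecord_aPacketOfRecordU (hfib : ∀ v : HeightOneSpectrum (𝓞 ↥(maximalRealSubfield L)), (𝔩 v).XiHFibreLawOneDim)
    (h8U : ∀ v : HeightOneSpectrum (𝓞 ↥(maximalRealSubfield L)), (𝔩 v).OneDimHLawU)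
    (hunrU : ∀ ξ : OneDimAutRepH L, ∀ᶠ v : HeightOneSpectrum (𝓞 ↥(maximalRealSubfield L)) in cofinite, (𝔩 v).unr ((𝔩 v).xiH ((GlobalPacketH.rhoXiU h8U ξ).loc v)))
    (ξ : OneDimAutRepH L) (hAtok : ∀ v : HeightOneSpectrum (𝓞 ↥(maximalRealSubfield L)), (𝔩 v).xiH ((GlobalPacketH.rhoXiU h8U ξ).loc v) ∈ aTokOfRecord 𝔩 Pk v)
    (hdisc : ((GlobalPacketH.rhoXiU h8U ξ).imageG (hunrU ξ)).IsDiscrete μ) :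
    nGOfRecord 𝔩 𝔞 μ μ₂ μ₁ Pk (aPacketOfRecordU 𝔩 𝔞 μ Pk h8U hunrU ξ hAtok hdisc) = 1 / 2 := by
  rw [nGOfRecord_eq]
  exact aPacketGOfOneDimU_n_eq_half h8U hunrU ξ (infOfOfRecord 𝔩 𝔞 μ) (aTokOfRecord 𝔩 Pk) hAtok hdisc hfib (fun σ => ∃ π₂ χ₁ hχ₁, IsRealisedH 𝔩 μ₂ μ₁ σ π₂ χ₁ hχ₁)
    ⟨piTwoOfOneDim ξ, chiOneOfOneDim ξ, isOpen_ker_chiOneOfOneDim ξ, isRealisedH_shape_rhoXiU μ₂ μ₁ h8U ξ⟩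

/-- **V8′ · reader: `(gOfRecord …).n (aPacketOfRecordU …) = ½`** (V8 through §2.1 `gOfRecord_n`, `rfl`). [cite: Rogawski1990, §13.3 Thm. 13.3.7 pp. 202–203] -/
theorem gOfRecord_n_aPacketOfRecordU (hfib : ∀ v : HeightOneSpectrum (𝓞 ↥(maximalRealSubfield L)), (𝔩 v).XiHFibreLawOneDim)
    (h8U : ∀ v : HeightOneSpectrum (𝓞 ↥(maximalRealSubfield L)), (𝔩 v).OneDimHLawU)
    (hunrU : ∀ ξ : OneDimAutRepH L, ∀ᶠ v : HeightOneSpectrum (𝓞 ↥(maximalRealSubfield L)) in cofinite, (𝔩 v).unr ((𝔩 v).xiH ((GlobalPacketH.rhoXiU h8U ξ).loc v)))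
    (ξ : OneDimAutRepH L) (hAtok : ∀ v : HeightOneSpectrum (𝓞 ↥(maximalRealSubfield L)), (𝔩 v).xiH ((GlobalPacketH.rhoXiU h8U ξ).loc v) ∈ aTokOfRecord 𝔩 Pk v)
    (hdisc : ((GlobalPacketH.rhoXiU h8U ξ).imageG (hunrU ξ)).IsDiscrete μ) :
    (gOfRecord 𝔩 𝔞 𝔞H μ μ₂ μ₁ archH Pk μω pairG).n (aPacketOfRecordU 𝔩 𝔞 μ Pk h8U hunrU ξ hAtok hdisc) = 1 / 2 :=
  nGOfRecord_aPacketOfRecordU hfib h8U hunrU ξ hAtok hdisc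

end S9Payers

end Summit.HodgeConjecture.HodgeConjecture.R90.S5
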